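import Mathlib
import Literature.MathematicalPhysics.QuantumFieldTheory.Balaban1983to89.B5Ineq113

/-!
# B5 (1.110)/(1.111) for G′ = G′_k via the representation (1.135) — the residual `ResidualGpFirst` of S3

Paper **B5** = T. Bałaban, *Propagators and renormalization transformations for lattice gauge theories. I*,
Comm. Math. Phys. **95** (1984) 17–40 [cite: Balaban1984PropagatorsI]; **[2]** of B5 = paper **B4** = T. Bałaban,
*Regularity and decay of lattice Green's functions*, Comm. Math. Phys. **89** (1983) 571–597
[cite: Balaban1983RegularityDecay].  Page numbers are journal pages (B5: PDF page + 16; B4: PDF page + 570).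

## What the paper prints (verbatim, from the page renders)

* B5 Proposition 1.2, p. 35: «There exists a positive constant δ₀ depending on d only, such that
  |(GJ)(x)|, |(∇GJ)(x)|, |(G∇*J)(x)|, |(ΔGJ)(x)| ≤ O(1)e^{−δ₀|y−y′|}|J| (1.110) for x ∈ Δ̃(y), supp J ⊂ Δ̃(y′), with
  the constant O(1) depending on d only, ‖ζ∇GJ‖_α, ‖ζG∇*J‖_α ≤ O(1)e^{−δ₀|y−y′|}(‖ζ‖_α + |ζ|)|J| (1.111) for
  0 ≤ α < 1, ζ ∈ C₀^∞(Δ̃(y)), supp J ⊂ Δ̃(y′), with the constant O(1) depending on d» — p. 36, first line — «and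
  α(O(1) → ∞ if α → 1),».
* B5 p. 35, (1.108)–(1.109): «|A| = max_μ sup_x |A_μ(x)|», «‖A‖_α = max_μ sup_{x,x′:|x−x′|≤1} (1/|x − x′|^α)
  |A_μ(x) − A_μ(x′)|».
* B5 p. 39 [PDF 23]: «G = G₀ + G₀∂P∂*G, (1.132) where G₀ = (Δ + aQ*Q)^{−1}. This operator is similar to G′, but
  with the different averaging operator. We will prove (1.115)–(1.117), and in fact the whole Proposition 1.2,
  for the operator G₀.»; «Properties of the operator G₀ can be easily reduced to the corresponding properties of
  the operator G′ by the equality G₀ = G′ + G′(a_kQ′*Q′ − aQ*Q)G₀. (1.133)»; and «In paper [2] we have proved all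
  the necessary properties of G′, except the second order inequalities (1.112), (1.113). Let us prove for example
  (1.112). We use Lemma 2.4 of that paper and the equality (2.34) with □ replaced by the whole torus. Let us write
  this equality again, G′_k = C^{(0),η} + Σ_{j=1}^{k−1} a_j²(L^jη)^{−4} G′^η_j Q′*_j C^{(j),L^jη} Q′_j G′^η_j , (1.135)».
  B5 p. 21 (1.21): «where Δ is η-lattice Laplace operator for scalar functions and ∂* is the divergence operator
  for vector functions»; p. 22: «the Laplace operator Δ on the torus T_η. It is a symmetric, non-negative
  operator»; p. 35: «Cubes Δ(y) are simply unit cubes of T_η, or Δ(y) = B^k(y), y ∈ T₁^{(k)}. Cubes Δ̃(y) are sums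
  of 2^d unit cubes having the point y as a corner, thus they are cubes of size 2 and with a center at y.»
* B4 p. 582 [PDF 12]: «This proof is based on renormalization group equations (2.43) of [1] rescaled to the
  η-lattice: G_k(□) = C^{(0),η}(□) + Σ_{j=1}^{k−1} a_j²(L^jη)^{−4}G^η_j(□)Q*_jC^{(j),L^jη}(□)Q_jG^η_j(□). (2.34)»;
  «Lemma 2.4. There exist positive constants c₀, δ₀, and for α < 1, there exists a constant c₁, such that
  |(G_j(□)Q*_j)(x, y)|, |(∂^{L^{−j}}_μG_j(□)Q*_j)(x, y)| ≤ c₀e^{−δ₀|x−y|}, (2.35) … |C^{(j)}(□; y, y′)| ≤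
  c₀e^{−δ₀|y−y′|}, (2.37) for arbitrary non-negative integer j, arbitrary, rectangular parallelepiped □ ⊂ L^{−j}Z^d
  built of large blocks, and x, x′ ∈ □, y, y′ ∈ □^{(j)} = □ ∩ Z^d.»; and the printed first-order Hölder
  bookkeeping over the scales of (2.34), (2.38)–(2.39): «hence Lemma 2.4 implies (1/|x − x′|^α)|(∂^η_μG_k(□)f)(x) −
  (∂^η_μG_k(□)f)(x′)| ≤ η^{1−α}4c₀O(1)‖f‖_∞ + Σ_{j=1}^{k−1} a_j²(L^jη)^{1−α}c₁ Σ_{y∈(L^jη)^{−1}□^{(j)}}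
  e^{−δ₀dist({(L^jη)^{−1}x,(L^jη)^{−1}x′},y)}·|(C^{(j)}((L^jη)^{−1}□)Q_jG_j((L^jη)^{−1}□)f)(y)| ≤
  O(1) Σ_{j=0}^{k−1} (L^jη)^{1−α}‖f‖_∞ ≤ c′₁‖f‖_∞, (2.39)».

## What this module does (kernel-checked) and what it does NOT do

The family-level conversion `B5FromB4.prop12G0_of_B4` (S3, p. 39: Proposition 1.2 for G₀ = G′-with-Q) takes the
first-order G′ entries |G′∇*J|, |ΔG′J| of (1.110) and ‖ζG′∇*J‖_α of (1.111) as the NAMED RESIDUAL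
`B5FromB4.ResidualGpFirst` («In paper [2] we have proved all the necessary properties of G′ …» — but [2] =
B4 Theorem 1′ prints only sup|Gf|, sup|∇Gf| and the α₀-Hölder quotient of ∇Gf, cf. the docstring of
`B5FromB4.ResidualGpFirst`).  Here that residual is DERIVED, for every instance of a family, from:
(i) two instances of the printed representation (1.135) written at kernel level — `Display135 (dataR D P) L d 1`
for (G′_k∂*_νf)(x) (one lattice derivative fewer than the printed (1.136), hence the scale factor (L^jη)^{+1})
and `Display135 (dataZ D P) L d 2` for (G′_kf)(x) (no derivative, factor (L^jη)^{+2}) — these displays are OUR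
READING of (1.135) «with □ replaced by the whole torus» exactly as (1.136) is the paper's reading of it for
∂_μG′_k∂*_ν, and they remain NAMED HYPOTHESES (no operator theory is formalised); (ii) B4 Lemma 2.4 AS PRINTED
(`B4.Lemma24Printed`, (2.35)–(2.37)) read on the torus through the dictionary `Dict24Gp` (the analogue of
`B5Ineq137.Dict24` for the kernels G′_jQ′*_j, Q′_jG′_j without derivative, plus a discrete mean-value field
bounding a unit-lattice difference quotient of (G′_jQ′*_j)(·, y) by the derivative kernel of (2.35)); (iii) the
lattice identity ΔG′_k = I − a_kQ′*_kQ′_kG′_k (from G′_k = (Δ + a_kQ′*_kQ′_k)^{−1} — (1.132)–(1.133), p. 39: G₀ =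
(Δ + aQ*Q)^{−1} «is similar to G′, but with the different averaging operator») in the weak kernel form
`LaplaceLeaf`; (iv) the norm dictionary `DictGp` ((1.108)–(1.109) for the entries e 2, e 3 of
`B5.Setting` and the component `hS` = ‖ζG′∇*J‖_α of `B5FromB4.GpHolder`), and the row-sum / geometry /
norm-facts hypotheses of `B5Ineq137` / `B5Ineq113` unchanged.  KERNEL-CHECKED: the real-arithmetic estimate
"(1.135) + (2.35)–(2.37) ⟹ (1.110) (entries G′∇*, ΔG′) and (1.111) (entry ζG′∇*)", including the printed
α-dependence «O(1) → ∞ if α → 1» in the explicit form 1/(L^{1−α} − 1) (theorems `sup_of_display135`,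
`ineq111At_of_display135`, `residualGpFirst_of_display135`), and the corollary `prop12G0_of_B4_via135` =
`B5Ineq113.prop12G0_of_B4_via137_113` with `hRes` discharged as well.

WHAT REMAINS A NAMED HYPOTHESIS (located, not proved): the displays `Display135 (dataR D P) L d 1`,
`Display135 (dataZ D P) L d 2` (our kernel-level reading of (1.135) = [2] (2.34) on the torus); `Dict24Gp`
(B4 Lemma 2.4 is printed for a rectangular parallelepiped □ with Neumann boundary conditions, B5 uses it «with □
replaced by the whole torus»; its `lip` field is the elementary lattice mean-value inequality, not printed);
`LaplaceLeaf` (the resolvent identity for G′_k, not printed in this form); `DictGp`, `B5Ineq137.Dict137`,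
`B5Ineq137.Geometry`, `B5Ineq113.Geometry113`, `B5Ineq137.RowSums`, `B5Ineq137.NormFacts` (model facts about the
torus, its cubes Δ̃(y) and the norms (1.108)–(1.109)); and everything upstream in `B5FromB4.prop12G0_of_B4`
(B4 Theorems 1, 1′ as printed, the second-order G′ displays of `B5Ineq137`/`B5Ineq113`, the L² entries).
Nothing here is progress on any Millennium problem: it is bookkeeping that turns one more informally juxtaposed
residual of the B4 → B5 interface into kernel-checked arithmetic over located leaves.
-/

namespace Literature.MathematicalPhysics.QuantumFieldTheory.Balaban1983to89.B5Ineq110Gp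

open Finset B5Ineq137 B5Ineq113

/-! ## §1. Real-arithmetic helpers (scale bookkeeping of (1.135) with one or no lattice derivative) -/

/-- Crude scales in the Hölder estimate of (1.111): if the scale length s = L^{j−k} = L^jη satisfies s ≤ ρ = |x₁ − x₂|
then s ≤ ρ^α s^{1−α} (0 ≤ α).  [folklore] -/
theorem crude_scale_le {s ρ α : ℝ} (hs : 0 < s) (hα : 0 ≤ α) (hcrude : s ≤ ρ) :
    s ≤ ρ ^ α * s ^ (1 - α) := by
  have h := scale_pow_crude_le (ε := 1 - α) hs hα hcrude
  rwa [show α + (1 - α) = 1 by ring, Real.rpow_one] at h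

/-- Fine scales in the Hölder estimate of (1.111): with N = L^{k−j} = (L^jη)^{−1}, sN = 1 and Nρ ≤ 1 one has
s·(Nρ) = ρ ≤ ρ^α s^{1−α} (α ≤ 1), since ρ ≤ s.  [folklore] -/
theorem fine_scale_le {s N ρ α : ℝ} (hs : 0 < s) (hρ : 0 ≤ ρ) (hsN : s * N = 1) (hα1 : α ≤ 1)
    (hfine : N * ρ ≤ 1) : s * (N * ρ) ≤ ρ ^ α * s ^ (1 - α) := by
  have hlhs : s * (N * ρ) = ρ := by
    calc s * (N * ρ) = s * N * ρ := by ring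
      _ = ρ := by rw [hsN, one_mul]
  have hρs : ρ ≤ s := by
    have h1 : s * (N * ρ) ≤ s * 1 := mul_le_mul_of_nonneg_left hfine hs.le
    rw [hlhs, mul_one] at h1
    exact h1
  rw [hlhs]
  rcases eq_or_lt_of_le hρ with h0 | hpos
  · rw [← h0]
    exact le_of_eq_of_le rfl (mul_nonneg (Real.rpow_nonneg le_rfl _) (Real.rpow_nonneg hs.le _))
  · calc ρ = ρ ^ α * ρ ^ (1 - α) := by
          rw [← Real.rpow_add hpos, show α + (1 - α) = 1 by ring, Real.rpow_one]
      _ ≤ ρ ^ α * s ^ (1 - α) :=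
          mul_le_mul_of_nonneg_left (Real.rpow_le_rpow hρ hρs (by linarith)) (Real.rpow_nonneg hρ _)

/-- Scale sums with at least one missing derivative: Σ_{j<k} (L^{j−k})^m ≤ 1/(L − 1) for m ≥ 1, L > 1 (each
(L^jη)^m ≤ L^jη ≤ 1 and `B5FromB4.scale_sum_bound` with ε = 1).  [folklore] -/
theorem scale_sum_pow_le {L : ℝ} (hL : 1 < L) (k m : ℕ) (hm : 1 ≤ m) :
    ∑ j ∈ Finset.range k, (L ^ ((j : ℝ) - k)) ^ m ≤ 1 / (L - 1) := by
  have hL0 : 0 < L := lt_trans zero_lt_one hL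
  have h1 : ∑ j ∈ Finset.range k, (L ^ ((j : ℝ) - k)) ^ m ≤ ∑ j ∈ Finset.range k, L ^ ((j : ℝ) - k) := by
    refine Finset.sum_le_sum fun j hj => ?_
    have hjk : (j : ℝ) - k ≤ 0 := by
      have h := Finset.mem_range.mp hj
      have h' : (j : ℝ) < k := by exact_mod_cast h
      linarith
    exact pow_le_of_le_one (Real.rpow_nonneg hL0.le _) (Real.rpow_le_one_of_one_le_of_nonpos hL.le hjk)
      (by omega)
  have h2 := B5FromB4.scale_sum_bound L 1 hL one_pos k
  simp only [Real.rpow_one] at h2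
  exact h1.trans h2

/-- `1/(L − 1) ≤ 1/(L^{1−α} − 1)` for L > 1, 0 ≤ α < 1: the sup constant of (1.110) is dominated by the Hölder
constant of (1.111).  [folklore] -/
theorem inv_gap_le_inv_gap_rpow {L α : ℝ} (hL : 1 < L) (hα0 : 0 ≤ α) (hα1 : α < 1) :
    1 / (L - 1) ≤ 1 / (L ^ (1 - α) - 1) := by
  have h := inv_scale_gap_mono (ε := 1 - α) (α := α) hL (by linarith) hα0
  rwa [show α + (1 - α) = 1 by ring, Real.rpow_one] at h


/-! ## §2. The carrier: the kernels of (1.135) for G′_k∂*_ν and for G′_k, and the located leaves -/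

variable {S : B5.Setting}

/-- The additional kernel data of ONE instance (k, T_η) needed to write (1.135) for the operators G′_k∂*_ν
(one lattice derivative, on the right) and G′_k (no derivative), on top of a `B5Ineq137.ScaleData` D (which
carries the kernels of (1.136) for ∂_μG′_k∂*_ν): `K0R ν x x′` = the kernel of the term C^{(0),η}∂*_ν rescaled to
the unit lattice η^{−1}T_η (written (C^{(0)}∂*_ν)(η^{−1}x, η^{−1}x′)), `K00 x x′` = C^{(0)}(η^{−1}x, η^{−1}x′);
`K1n j x y` = (G′_jQ′*_j)((L^jη)^{−1}x, y) and `K3n j y′ x′` = (Q′_jG′_j)(y′, (L^jη)^{−1}x′) — the kernels of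
(2.35) WITHOUT derivative; `E1 ν f x` = (G′_k∂*_νf)(x), `E0 f x` = (G′_kf)(x), `EL f x` = (ΔG′_kf)(x) (Δ the
lattice Laplacian of T_η); `w x x″` = the weights of the block-averaging kernel (Q′*_kQ′_k)(x, x″) (non-negative,
row sums ≤ 1, range O(1) — hypotheses of `LaplaceLeaf`).  [cite: Balaban1984PropagatorsI, (1.135) p.39;
Balaban1983RegularityDecay, (2.34)–(2.35) p.582] -/
structure GpData (D : ScaleData S) where
  K00 : D.X → D.X → ℝ
  K0R : D.Dir → D.X → D.X → ℝ
  K1n : ℕ → D.X → D.U → ℝ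
  K3n : ℕ → D.U → D.X → ℝ
  E1 : D.Dir → D.F → D.X → ℝ
  E0 : D.F → D.X → ℝ
  EL : D.F → D.X → ℝ
  w : D.X → D.X → ℝ

/-- The `ScaleData` of the operator G′_k∂*_ν: the carrier D with the kernels of (1.136) replaced by those of
(1.135)·∂*_ν — K0 ↦ (C^{(0)}∂*_ν), K1 ↦ G′_jQ′*_j (no derivative), K3 = Q′_jG′_j∂*_ν unchanged, E ↦ G′_k∂*_ν
(the index μ becomes a dummy).  With this substitution `B5Ineq137.kerW (dataR D P) j μ ν` is literally the j-th
kernel of (1.135)·∂*_ν.  [cite: Balaban1984PropagatorsI, (1.135) p.39] -/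
abbrev dataR (D : ScaleData S) (P : GpData D) : ScaleData S :=
  { D with
    K0 := fun _ ν x x' => P.K0R ν x x'
    K1 := fun j _ x y => P.K1n j x y
    E := fun _ ν f x => P.E1 ν f x }

/-- The `ScaleData` of the operator G′_k itself: K0 ↦ C^{(0)}, K1 ↦ G′_jQ′*_j, K3 ↦ Q′_jG′_j, E ↦ G′_k (both
indices μ, ν dummies).  [cite: Balaban1984PropagatorsI, (1.135) p.39] -/
abbrev dataZ (D : ScaleData S) (P : GpData D) : ScaleData S :=
  { D with
    K0 := fun _ _ x x' => P.K00 x x'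
    K1 := fun j _ x y => P.K1n j x y
    K3 := fun j _ y x' => P.K3n j y x'
    E := fun _ _ f x => P.E0 f x }

/-- **(1.135) at kernel level with m missing derivatives** (m = 1: G′_k∂*_ν; m = 2: G′_k), OUR READING of
«the equality (2.34) with □ replaced by the whole torus … G′_k = C^{(0),η} + Σ_{j=1}^{k−1} a_j²(L^jη)^{−4}
G′^η_jQ′*_jC^{(j),L^jη}Q′_jG′^η_j (1.135)» (p. 39) in the bookkeeping of the printed (1.136) (p. 40): for x ∈ T_η,
(Ef)(x) = Σ_{j=0}^{k−1} (L^jη)^m Σ_{x′∈T_η} (L^jη)^d · kerW_j(x, x′) f(x′), where kerW_0 = the C^{(0),η}-term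
kernel and kerW_j = a_j² Σ_{y,y′} K1_j(x̃, y) C^{(j)}(y, y′) K3_j(y′, x̃′) (`B5Ineq137.kerW`), L^jη = L^{j−k} and
(L^jη)^d = (L^{jd})^{−1}·(unit volume).  Each lattice derivative removed from the printed ∂_μG′_k∂*_ν of (1.136)
contributes one factor (L^jη)^{+1} ((1.136) carries (L^jη)^{−2}·(L^jη)^{2} = 1 for two derivatives); no
Hölder dressing and no subtraction f(x′) − f(x) (those are specific to (1.112)).  A NAMED HYPOTHESIS.
[cite: Balaban1984PropagatorsI, (1.135)–(1.136) pp.39–40] -/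
def Display135 (D : ScaleData S) (L : ℝ) (d m : ℕ) : Prop :=
  ∀ (μ ν : D.Dir) (f : D.F) (x : D.X), x ∈ D.TX →
    D.E μ ν f x = ∑ j ∈ Finset.range S.k, (L ^ ((j : ℝ) - S.k)) ^ m *
      ∑ x' ∈ D.TX, (L ^ (j * d))⁻¹ * kerW D j μ ν x x' * D.eval f x'

/-- The j-th scale term of `Display135` without its prefactor (L^jη)^m:
Σ_{x′∈T_η} (L^{jd})^{−1} kerW_j(x, x′) f(x′).  [cite: Balaban1984PropagatorsI, (1.135)–(1.136) pp.39–40] -/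
noncomputable def termP (D : ScaleData S) (L : ℝ) (d j : ℕ) (μ ν : D.Dir) (f : D.F) (x : D.X) : ℝ :=
  ∑ x' ∈ D.TX, (L ^ (j * d))⁻¹ * kerW D j μ ν x x' * D.eval f x'

/-- **Dictionary: B4 Lemma 2.4 (2.35)–(2.37), read on the torus, for the kernels of (1.135) without / with one
derivative** (the analogue of `B5Ineq137.Dict24`).  `mid`: for each scale 1 ≤ j ≤ k − 1 an instance i of the
Lemma-2.4 family with `rectLarge` (□ «built of large blocks») and maps σ, τ, dir with |K1n_j(x̃, y)| ≤ (the
majorant `kerGQ` of |(G_jQ*_j)(x, y)| in (2.35)), |K3n_j(y′, x̃′)| ≤ kerGQ (by symmetry of G_j),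
|K3_j(ν; y′, x̃′)| ≤ `kerDGQ` (the majorant of |(∂^{L^{−j}}G_jQ*_j)(x, y)| in (2.35)), |K2_j| ≤ `kerC` ((2.37)),
the distances matched; and the field `lip` — the elementary LATTICE MEAN-VALUE INEQUALITY on the L^{−j}-lattice:
for |x̃₁ − x̃₂| = L^{k−j}|x₁ − x₂| ≤ 1, (G_jQ*_j)(x̃₁, y) − (G_jQ*_j)(x̃₂, y) is a sum of at most pL·|x̃₁ − x̃₂|
(times the lattice spacing) values of the derivative kernel (∂^{L^{−j}}_{μ′}G_jQ*_j)(z, y) at points z of a lattice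
path from x̃₁ to x̃₂, all within distance pL of x̃₁ — recorded through ONE dominating point z (the maximum).  `zero`:
the C^{(0),η}-terms (with / without ∂*_ν) are sums of at most 4 values of C^{(0)} ((2.37), j = 0) at points
within s₀ of each other.  B4 Lemma 2.4 is printed for □ with Neumann boundary conditions; B5 p. 39 uses it «with
□ replaced by the whole torus» — this dictionary is exactly that located reading, a NAMED HYPOTHESIS.
[cite: Balaban1983RegularityDecay, Lemma 2.4 (2.35)–(2.37) p.582; Balaban1984PropagatorsI, p.39] -/
structure Dict24Gp {I₂₄ : Type} (fam₂₄ : I₂₄ → B4.ScaleSetting) (D : ScaleData S) (P : GpData D)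
    (L s₀ pL : ℝ) : Prop where
  mid : ∀ j : ℕ, 1 ≤ j → j < S.k → ∃ i : I₂₄, (fam₂₄ i).rectLarge ∧
    ∃ (σ : D.X → (fam₂₄ i).SiteF) (τ : D.U → (fam₂₄ i).SiteU) (dir : D.Dir → (fam₂₄ i).Dir),
      (∀ (x : D.X) (y : D.U), |P.K1n j x y| ≤ (fam₂₄ i).kerGQ (σ x) (τ y)) ∧
      (∀ (y : D.U) (x' : D.X), |P.K3n j y x'| ≤ (fam₂₄ i).kerGQ (σ x') (τ y)) ∧
      (∀ (ν : D.Dir) (y : D.U) (x' : D.X), |D.K3 j ν y x'| ≤ (fam₂₄ i).kerDGQ (dir ν) (σ x') (τ y)) ∧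
      (∀ y y' : D.U, |D.K2 j y y'| ≤ (fam₂₄ i).kerC (τ y) (τ y')) ∧
      (∀ (x : D.X) (y : D.U), (fam₂₄ i).distF (σ x) (τ y) = D.dXU j x y) ∧
      (∀ y y' : D.U, (fam₂₄ i).distU (τ y) (τ y') = D.dUU j y y') ∧
      (∀ (x₁ x₂ : D.X) (y : D.U), L ^ (S.k - j) * D.distX x₁ x₂ ≤ 1 →
        ∃ (z : (fam₂₄ i).SiteF) (μ' : (fam₂₄ i).Dir),
          |P.K1n j x₁ y - P.K1n j x₂ y| ≤
              pL * (L ^ (S.k - j) * D.distX x₁ x₂) * (fam₂₄ i).kerDGQ μ' z (τ y) ∧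
            D.dXU j x₁ y - pL ≤ (fam₂₄ i).distF z (τ y))
  zero : ∃ i : I₂₄, (fam₂₄ i).rectLarge ∧
    ∃ (P₀ : D.X → D.X → Finset ((fam₂₄ i).SiteU × (fam₂₄ i).SiteU))
      (P₁ : D.Dir → D.X → D.X → Finset ((fam₂₄ i).SiteU × (fam₂₄ i).SiteU)),
      (∀ x x', (P₀ x x').card ≤ 4) ∧ (∀ ν x x', (P₁ ν x x').card ≤ 4) ∧
      (∀ x x', |P.K00 x x'| ≤ ∑ p ∈ P₀ x x', (fam₂₄ i).kerC p.1 p.2) ∧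
      (∀ ν x x', |P.K0R ν x x'| ≤ ∑ p ∈ P₁ ν x x', (fam₂₄ i).kerC p.1 p.2) ∧
      (∀ x x', ∀ p ∈ P₀ x x', L ^ S.k * D.distX x x' - s₀ ≤ (fam₂₄ i).distU p.1 p.2) ∧
      (∀ ν x x', ∀ p ∈ P₁ ν x x', L ^ S.k * D.distX x x' - s₀ ≤ (fam₂₄ i).distU p.1 p.2)

/-- **The resolvent identity for G′_k in weak kernel form** (located leaf): G′_k = (Δ + a_kQ′*_kQ′_k)^{−1}
((1.132)–(1.133), p. 39: G₀ = (Δ + aQ*Q)^{−1} «is similar to G′, but with the different averaging operator»; Δ the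
η-lattice Laplace operator of (1.21), «a symmetric, non-negative operator», p. 22), so ΔG′_k = I − a_kQ′*_kQ′_kG′_k
and hence |(ΔG′_kf)(x)| ≤ |f(x)| + a_k Σ_{x″} w(x, x″)|(G′_kf)(x″)| with the block-averaging weights w ≥ 0 of
Q′*_kQ′_k (Q′_k averages over the unit cubes B^k(y), p. 35): Σ_{x″} w(x, x″) ≤ 1 and w(x, x″) = 0 unless x, x″ lie
in the same unit cube, |x − x″| ≤ cb.  Not printed in B5 in this form; a NAMED HYPOTHESIS (model fact about the
operators of Sect. B), with a_k ≥ 0 a separate hypothesis of the assembly.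
[cite: Balaban1984PropagatorsI, (1.132)–(1.133), (1.135) p.39; (1.21) p.21] -/
structure LaplaceLeaf (D : ScaleData S) (P : GpData D) (aK cb : ℝ) : Prop where
  lap : ∀ (f : D.F) (x : D.X), x ∈ D.TX →
    |P.EL f x| ≤ |D.eval f x| + aK * ∑ x'' ∈ D.TX, P.w x x'' * |P.E0 f x''|
  w_nonneg : ∀ x x'', 0 ≤ P.w x x''
  w_sum : ∀ x, x ∈ D.TX → ∑ x'' ∈ D.TX, P.w x x'' ≤ 1
  w_near : ∀ x x'', P.w x x'' ≠ 0 → D.distX x x'' ≤ cb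

/-- **Dictionary (1.108)–(1.109) ↔ the entries e 2, e 3 of `B5.Setting` and the component hS of
`B5FromB4.GpHolder`** (the analogue of `B5Ineq137.Dict137.e4_le` / `B5Ineq113.Dict113`): `e2_le` — S.e 2 J y =
sup_{x∈Δ̃(y)}|(G′∇*J)(x)| with (G′∇*J)(x) = Σ_ν (G′∂*_νJ_ν)(x), so a bound b on every |(G′_k∂*_νJ_ν)(x)|, x ∈ Δ̃(y),
gives S.e 2 J y ≤ d·b; `e3_le` — S.e 3 J y = sup_{x∈Δ̃(y)}|(ΔG′J)(x)|, (ΔG′J)_μ = ΔG′_kJ_μ componentwise, and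
the pointwise norm of a d-vector is at most d times the largest component (whether |·| is the maximum, Euclidean
or ℓ¹ norm), so a bound b on every |(ΔG′_kJ_μ)(x)|, x ∈ Δ̃(y), gives S.e 3 J y ≤ d·b; `hS_le` — hS J α ζ =
‖ζG′∇*J‖_α ((1.109): pairs |x − x′| ≤ 1, x ≠ x′, one point in Δ̃(y) ⊇ supp ζ w.l.o.g.), and ζ(x₁)g(x₁) −
ζ(x₂)g(x₂) = ζ(x₁)(g(x₁) − g(x₂)) + (ζ(x₁) − ζ(x₂))g(x₂) with |ζ(x₁)|, |ζ(x₁) − ζ(x₂)|/|x₁ − x₂|^α ≤ ‖ζ‖_α + |ζ| =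
`S.cutH α ζ`: a bound |g(x₁)| ≤ b at the points of Δ̃(y) together with |g(x₁) − g(x₂)| ≤ b|x₁ − x₂|^α ∧
|g(x₂)| ≤ b on such pairs, for g = G′_k∂*_νJ_ν, gives hS ≤ d·cutH·b (the factor d from the sum over ν).  Facts
about the model's norms; NAMED HYPOTHESES.  [cite: Balaban1984PropagatorsI, (1.108)–(1.111) p.35] -/
structure DictGp (D : ScaleData S) (P : GpData D) (F : B5FromB4.GpHolder S) (d : ℕ) : Prop where
  e2_le : ∀ (J : S.Loc) (y : S.Site) (b : ℝ),
    (∀ (ν : D.Dir) (x : D.X), x ∈ D.TX → D.cube x y → |P.E1 ν (D.comp J ν) x| ≤ b) → S.e 2 J y ≤ d * b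
  e3_le : ∀ (J : S.Loc) (y : S.Site) (b : ℝ),
    (∀ (μ : D.Dir) (x : D.X), x ∈ D.TX → D.cube x y → |P.EL (D.comp J μ) x| ≤ b) → S.e 3 J y ≤ d * b
  hS_le : ∀ (J : S.Loc) (α : ℝ) (ζ : S.Cut) (y : S.Site) (b : ℝ), S.cutIn ζ y → 0 ≤ b →
    (∀ (ν : D.Dir) (x₁ : D.X), x₁ ∈ D.TX → D.cube x₁ y →
      |P.E1 ν (D.comp J ν) x₁| ≤ b ∧
      ∀ x₂ : D.X, x₂ ∈ D.TX → x₁ ≠ x₂ → D.distX x₁ x₂ ≤ 1 →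
        |P.E1 ν (D.comp J ν) x₁ - P.E1 ν (D.comp J ν) x₂| ≤ b * D.distX x₁ x₂ ^ α ∧
          |P.E1 ν (D.comp J ν) x₂| ≤ b) →
    F.hS J α ζ ≤ d * S.cutH α ζ * b

/-- **(1.110) at kernel level for one display** (sup entries): for x ∈ Δ̃(y) ∩ T_η and supp f ⊂ Δ̃(y′),
|(Ef)(x)| ≤ C e^{−δ|y−y′|} |f|.  [cite: Balaban1984PropagatorsI, (1.110) p.35] -/
def Ineq110At (D : ScaleData S) (C δ : ℝ) : Prop :=
  ∀ (μ ν : D.Dir) (f : D.F) (x : D.X) (y y' : S.Site), x ∈ D.TX → D.cube x y → suppF D f y' →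
    |D.E μ ν f x| ≤ C * Real.exp (-(δ * S.dist y y')) * D.supF f

/-- The same sup bound at points x″ within distance cb of a point x ∈ Δ̃(y) (needed for the ΔG′ entry through
`LaplaceLeaf`, whose averaging weights w(x, x″) have range cb).  [cite: Balaban1984PropagatorsI, (1.110) p.35] -/
def Ineq110Near (D : ScaleData S) (C δ cb : ℝ) : Prop :=
  ∀ (μ ν : D.Dir) (f : D.F) (x x'' : D.X) (y y' : S.Site), x ∈ D.TX → x'' ∈ D.TX → D.cube x y →
    D.distX x x'' ≤ cb → suppF D f y' →
    |D.E μ ν f x''| ≤ C * Real.exp (-(δ * S.dist y y')) * D.supF f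

/-- **(1.111) at kernel level for one display, pair form** (0 ≤ α < 1): for x₁ ≠ x₂ in T_η with |x₁ − x₂| ≤ 1,
x₁ ∈ Δ̃(y), supp f ⊂ Δ̃(y′): |(Ef)(x₁) − (Ef)(x₂)| ≤ C e^{−δ|y−y′|}|f| |x₁ − x₂|^α and |(Ef)(x₂)| ≤ C e^{−δ|y−y′|}|f|.
[cite: Balaban1984PropagatorsI, (1.111) p.35] -/
def Ineq111Pair (D : ScaleData S) (α C δ : ℝ) : Prop :=
  ∀ (μ ν : D.Dir) (f : D.F) (x₁ x₂ : D.X) (y y' : S.Site),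
    x₁ ∈ D.TX → x₂ ∈ D.TX → x₁ ≠ x₂ → D.distX x₁ x₂ ≤ 1 → D.cube x₁ y → suppF D f y' →
    |D.E μ ν f x₁ - D.E μ ν f x₂| ≤ C * Real.exp (-(δ * S.dist y y')) * D.supF f * D.distX x₁ x₂ ^ α ∧
      |D.E μ ν f x₂| ≤ C * Real.exp (-(δ * S.dist y y')) * D.supF f

/-- **(1.111) at kernel level for one display** (Hölder entry, 0 ≤ α < 1): the sup bound |(Ef)(x₁)| ≤
C e^{−δ|y−y′|}|f| at every x₁ ∈ Δ̃(y) ∩ T_η together with the pair bounds of `Ineq111Pair` at every x₂ ≠ x₁,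
|x₁ − x₂| ≤ 1 (supp f ⊂ Δ̃(y′)) — exactly what the Hölder norm ‖ζ·Ef‖_α, supp ζ ⊂ Δ̃(y), is made of
(`DictGp.hS_le`).  [cite: Balaban1984PropagatorsI, (1.111) p.35] -/
def Ineq111At (D : ScaleData S) (α C δ : ℝ) : Prop :=
  ∀ (μ ν : D.Dir) (f : D.F) (x₁ : D.X) (y y' : S.Site), x₁ ∈ D.TX → D.cube x₁ y → suppF D f y' →
    |D.E μ ν f x₁| ≤ C * Real.exp (-(δ * S.dist y y')) * D.supF f ∧
      ∀ x₂ : D.X, x₂ ∈ D.TX → x₁ ≠ x₂ → D.distX x₁ x₂ ≤ 1 →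
        |D.E μ ν f x₁ - D.E μ ν f x₂| ≤
            C * Real.exp (-(δ * S.dist y y')) * D.supF f * D.distX x₁ x₂ ^ α ∧
          |D.E μ ν f x₂| ≤ C * Real.exp (-(δ * S.dist y y')) * D.supF f

/-! ### Transport of the model hypotheses of `B5Ineq137`/`B5Ineq113` to the swapped carriers (definitional) -/

/-- The geometry hypotheses of `B5Ineq137.Geometry` do not involve the swapped kernels: transport to `dataR` (definitional). [folklore] -/
theorem geometry_dataR {D : ScaleData S} (P : GpData D) {L cc : ℝ} (G : Geometry D L cc) :
    Geometry (dataR D P) L cc :=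
  ⟨G.distX_nonneg, G.dXU_nonneg, G.dUU_nonneg, G.tri, G.cube_sep, G.cube_near⟩

/-- Transport of `B5Ineq137.Geometry` to `dataZ` (definitional). [folklore] -/
theorem geometry_dataZ {D : ScaleData S} (P : GpData D) {L cc : ℝ} (G : Geometry D L cc) :
    Geometry (dataZ D P) L cc :=
  ⟨G.distX_nonneg, G.dXU_nonneg, G.dUU_nonneg, G.tri, G.cube_sep, G.cube_near⟩

/-- Transport of `B5Ineq113.Geometry113` to `dataR` (definitional). [folklore] -/
theorem geometry113_dataR {D : ScaleData S} (P : GpData D) {L : ℝ} (G : Geometry113 D L) :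
    Geometry113 (dataR D P) L :=
  ⟨G.triX, G.lattice_sep⟩

/-- Transport of `B5Ineq113.Geometry113` to `dataZ` (definitional). [folklore] -/
theorem geometry113_dataZ {D : ScaleData S} (P : GpData D) {L : ℝ} (G : Geometry113 D L) :
    Geometry113 (dataZ D P) L :=
  ⟨G.triX, G.lattice_sep⟩

/-- Transport of `B5Ineq137.RowSums` to `dataR` (definitional: the lattice sums do not involve the kernels). [folklore] -/
theorem rowSums_dataR {D : ScaleData S} (P : GpData D) {L : ℝ} {d : ℕ} {κ R Λ : ℝ}
    (Rw : RowSums D L d κ R Λ) : RowSums (dataR D P) L d κ R Λ :=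
  ⟨Rw.R_nonneg, Rw.Λ_nonneg, Rw.rowXU, Rw.rowUU, Rw.lat⟩

/-- Transport of `B5Ineq137.RowSums` to `dataZ` (definitional). [folklore] -/
theorem rowSums_dataZ {D : ScaleData S} (P : GpData D) {L : ℝ} {d : ℕ} {κ R Λ : ℝ}
    (Rw : RowSums D L d κ R Λ) : RowSums (dataZ D P) L d κ R Λ :=
  ⟨Rw.R_nonneg, Rw.Λ_nonneg, Rw.rowXU, Rw.rowUU, Rw.lat⟩

/-- Transport of `B5Ineq137.NormFacts` to `dataR` (definitional: the norms of f are unchanged). [folklore] -/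
theorem normFacts_dataR {D : ScaleData S} (P : GpData D) (N : NormFacts D) : NormFacts (dataR D P) :=
  ⟨N.holder_le, N.sup_le, N.holder_nonneg, N.sup_nonneg⟩

/-- Transport of `B5Ineq137.NormFacts` to `dataZ` (definitional). [folklore] -/
theorem normFacts_dataZ {D : ScaleData S} (P : GpData D) (N : NormFacts D) : NormFacts (dataZ D P) :=
  ⟨N.holder_le, N.sup_le, N.holder_nonneg, N.sup_nonneg⟩


/-! ## §3. Kernel-checked: (1.135) + (2.35)/(2.37) ⟹ (1.110) (sup entries) and (1.111) (Hölder entry) -/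

/-- **The x′ summation with the sup norm** (the analogue of the last step of (1.137) without Hölder dressing):
if every x′ with f(x′) ≠ 0 satisfies t − c′ ≤ |x − x′| then
Σ_{x′∈T_η} L^{−jd} e^{−(3/4)δ|(L^jη)^{−1}(x−x′)|}|f(x′)| ≤ e^{(1/2)δc′} e^{−(1/2)δt} |f| Λ
(`exp_three_quarter_split` + the Riemann sum `RowSums.lat` at rate ¼δ).  [cite: Balaban1984PropagatorsI, (1.137) p.40] -/
theorem supsum_le (D : ScaleData S) (L : ℝ) (d : ℕ) (δ cc c' t R Λ : ℝ) (hL : 1 < L) (hδ : 0 ≤ δ)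
    (G : Geometry D L cc) (Rw : RowSums D L d (δ / 4) R Λ) (N : NormFacts D)
    {j : ℕ} (hj : j < S.k) (f : D.F) (x : D.X) (hx : x ∈ D.TX)
    (hsep : ∀ x' ∈ D.TX, D.eval f x' ≠ 0 → t - c' ≤ D.distX x x') :
    ∑ x' ∈ D.TX, (L ^ (j * d))⁻¹ * Real.exp (-(3 / 4 * δ * (L ^ (S.k - j) * D.distX x x'))) *
        |D.eval f x'| ≤
      Real.exp (δ / 2 * c') * Real.exp (-(δ / 2 * t)) * D.supF f * Λ := by
  have hL0 : 0 < L := lt_trans zero_lt_one hL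
  have hM0 : 0 ≤ D.supF f := N.sup_nonneg f
  obtain ⟨A, hA⟩ : ∃ A : ℝ, A = Real.exp (δ / 2 * c') * Real.exp (-(δ / 2 * t)) * D.supF f := ⟨_, rfl⟩
  have hA0 : 0 ≤ A := by rw [hA]; positivity
  have key : ∀ x' ∈ D.TX,
      (L ^ (j * d))⁻¹ * Real.exp (-(3 / 4 * δ * (L ^ (S.k - j) * D.distX x x'))) * |D.eval f x'| ≤
        A * ((L ^ (j * d))⁻¹ * (Real.exp (-(δ / 4 * (L ^ (S.k - j) * D.distX x x'))) *
          (1 + L ^ (S.k - j) * D.distX x x'))) := by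
    intro x' hx'
    have hdX : 0 ≤ D.distX x x' := G.distX_nonneg x x'
    have hDt : 0 ≤ L ^ (S.k - j) * D.distX x x' := mul_nonneg (pow_nonneg hL0.le _) hdX
    have hLjd : 0 ≤ (L ^ (j * d))⁻¹ := inv_nonneg.mpr (pow_nonneg hL0.le _)
    by_cases hz : D.eval f x' = 0
    · rw [hz, abs_zero, mul_zero]
      exact mul_nonneg hA0 (mul_nonneg hLjd (mul_nonneg (Real.exp_nonneg _) (by linarith)))
    · have hsep' : t - c' ≤ L ^ (S.k - j) * D.distX x x' :=
        (hsep x' hx' hz).trans (dist_le_rescaled hL.le hdX _)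
      have hexp := exp_three_quarter_split hδ hsep'
      have hfx : |D.eval f x'| ≤ D.supF f := N.sup_le f x'
      calc (L ^ (j * d))⁻¹ * Real.exp (-(3 / 4 * δ * (L ^ (S.k - j) * D.distX x x'))) * |D.eval f x'|
          ≤ (L ^ (j * d))⁻¹ * (Real.exp (δ / 2 * c') * Real.exp (-(δ / 2 * t)) *
              Real.exp (-(δ / 4 * (L ^ (S.k - j) * D.distX x x')))) * D.supF f :=
            mul_le_mul (mul_le_mul_of_nonneg_left hexp hLjd) hfx (abs_nonneg _)
              (mul_nonneg hLjd (by positivity))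
        _ = A * ((L ^ (j * d))⁻¹ * (Real.exp (-(δ / 4 * (L ^ (S.k - j) * D.distX x x'))) * 1)) := by
            rw [hA]; ring
        _ ≤ A * ((L ^ (j * d))⁻¹ * (Real.exp (-(δ / 4 * (L ^ (S.k - j) * D.distX x x'))) *
              (1 + L ^ (S.k - j) * D.distX x x'))) :=
            mul_le_mul_of_nonneg_left (mul_le_mul_of_nonneg_left
              (mul_le_mul_of_nonneg_left (by linarith) (Real.exp_nonneg _)) hLjd) hA0
  calc ∑ x' ∈ D.TX, (L ^ (j * d))⁻¹ * Real.exp (-(3 / 4 * δ * (L ^ (S.k - j) * D.distX x x'))) *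
          |D.eval f x'|
      ≤ ∑ x' ∈ D.TX, A * ((L ^ (j * d))⁻¹ * (Real.exp (-(δ / 4 * (L ^ (S.k - j) * D.distX x x'))) *
          (1 + L ^ (S.k - j) * D.distX x x'))) := Finset.sum_le_sum key
    _ = A * ∑ x' ∈ D.TX, (L ^ (j * d))⁻¹ * (Real.exp (-(δ / 4 * (L ^ (S.k - j) * D.distX x x'))) *
          (1 + L ^ (S.k - j) * D.distX x x')) := by rw [Finset.mul_sum]
    _ ≤ A * Λ := mul_le_mul_of_nonneg_left (Rw.lat j x hj hx) hA0
    _ = Real.exp (δ / 2 * c') * Real.exp (-(δ / 2 * t)) * D.supF f * Λ := by rw [hA]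

/-- **Per-scale sup bound**: |Σ_{x′} L^{−jd} W_j(x, x′) f(x′)| ≤ (c₀ + ā²c₀³R²) e^{(1/2)δc′} e^{−(1/2)δt} |f| Λ,
from `B5Ineq137.kerW_bound` ((2.35)/(2.37) convolved) and `supsum_le`.  [cite: Balaban1984PropagatorsI, (1.137) p.40] -/
theorem termP_abs_le (D : ScaleData S) (L : ℝ) (d : ℕ) (c₀ δ cc ā R Λ c' t : ℝ) (hL : 1 < L)
    (hc₀ : 0 ≤ c₀) (hδ : 0 ≤ δ) (ha : ∀ j, |D.a j| ≤ ā) (hleaf : Leaf235to237 D L c₀ δ)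
    (G : Geometry D L cc) (Rw : RowSums D L d (δ / 4) R Λ) (N : NormFacts D)
    {j : ℕ} (hj : j < S.k) (μ ν : D.Dir) (f : D.F) (x : D.X) (hx : x ∈ D.TX)
    (hsep : ∀ x' ∈ D.TX, D.eval f x' ≠ 0 → t - c' ≤ D.distX x x') :
    |termP D L d j μ ν f x| ≤
      (c₀ + ā ^ 2 * c₀ ^ 3 * R ^ 2) *
        (Real.exp (δ / 2 * c') * Real.exp (-(δ / 2 * t)) * D.supF f * Λ) := by
  have hL0 : 0 < L := lt_trans zero_lt_one hL
  obtain ⟨CW, hCW⟩ : ∃ CW : ℝ, CW = c₀ + ā ^ 2 * c₀ ^ 3 * R ^ 2 := ⟨_, rfl⟩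
  have hCW0 : 0 ≤ CW := by rw [hCW]; positivity
  have hW : ∀ x', |kerW D j μ ν x x'| ≤
      CW * Real.exp (-(3 / 4 * δ * (L ^ (S.k - j) * D.distX x x'))) := by
    intro x'; rw [hCW]; exact kerW_bound D L c₀ δ cc ā R Λ d hL.le hc₀ hδ ha hleaf G Rw hj μ ν x x'
  rw [← hCW]
  unfold termP
  calc |∑ x' ∈ D.TX, (L ^ (j * d))⁻¹ * kerW D j μ ν x x' * D.eval f x'|
      ≤ ∑ x' ∈ D.TX, |(L ^ (j * d))⁻¹ * kerW D j μ ν x x' * D.eval f x'| :=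
        Finset.abs_sum_le_sum_abs _ _
    _ ≤ ∑ x' ∈ D.TX, CW * ((L ^ (j * d))⁻¹ *
          Real.exp (-(3 / 4 * δ * (L ^ (S.k - j) * D.distX x x'))) * |D.eval f x'|) := by
        refine Finset.sum_le_sum fun x' _ => ?_
        have hLjd : 0 ≤ (L ^ (j * d))⁻¹ := inv_nonneg.mpr (pow_nonneg hL0.le _)
        rw [abs_mul, abs_mul, abs_of_nonneg hLjd]
        calc (L ^ (j * d))⁻¹ * |kerW D j μ ν x x'| * |D.eval f x'|
            ≤ (L ^ (j * d))⁻¹ * (CW * Real.exp (-(3 / 4 * δ * (L ^ (S.k - j) * D.distX x x')))) *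
                |D.eval f x'| :=
              mul_le_mul_of_nonneg_right (mul_le_mul_of_nonneg_left (hW x') hLjd) (abs_nonneg _)
          _ = CW * ((L ^ (j * d))⁻¹ * Real.exp (-(3 / 4 * δ * (L ^ (S.k - j) * D.distX x x'))) *
                |D.eval f x'|) := by ring
    _ = CW * ∑ x' ∈ D.TX, (L ^ (j * d))⁻¹ *
          Real.exp (-(3 / 4 * δ * (L ^ (S.k - j) * D.distX x x'))) * |D.eval f x'| := by
        rw [Finset.mul_sum]
    _ ≤ CW * (Real.exp (δ / 2 * c') * Real.exp (-(δ / 2 * t)) * D.supF f * Λ) :=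
        mul_le_mul_of_nonneg_left (supsum_le D L d δ cc c' t R Λ hL hδ G Rw N hj f x hx hsep) hCW0

/-- **Per-scale difference bound at the fine scales** (1 ≤ j ≤ k − 1): with the kernel Hölder bound of
`B5Ineq113.kerW_holder` at exponent 1 (fed by the Lipschitz leaf `Leaf236 D L 1 c₁ δ`),
|Σ_{x′} L^{−jd}(W_j(x₁, x′) − W_j(x₂, x′))f(x′)| ≤ ā²c₁c₀²R² · L^{k−j}|x₁ − x₂| · 2e^{(1/2)δc′}e^{−(1/2)δt}|f|Λ.
[cite: Balaban1984PropagatorsI, (1.111) p.35, (1.135)–(1.137) pp.39–40] -/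
theorem termP_diff_le (D : ScaleData S) (L : ℝ) (d : ℕ) (c₀ c₁ δ cc ā R Λ c' t : ℝ) (hL : 1 < L)
    (hc₀ : 0 ≤ c₀) (hc₁ : 0 ≤ c₁) (hδ : 0 ≤ δ) (ha : ∀ j, |D.a j| ≤ ā) (hleaf : Leaf235to237 D L c₀ δ)
    (hlip : Leaf236 D L 1 c₁ δ) (G : Geometry D L cc) (Rw : RowSums D L d (δ / 4) R Λ) (N : NormFacts D)
    {j : ℕ} (hj1 : 1 ≤ j) (hj : j < S.k) (μ ν : D.Dir) (f : D.F) (x₁ x₂ : D.X) (hx₁ : x₁ ∈ D.TX)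
    (hx₂ : x₂ ∈ D.TX) (hne : x₁ ≠ x₂)
    (hsep₁ : ∀ x' ∈ D.TX, D.eval f x' ≠ 0 → t - c' ≤ D.distX x₁ x')
    (hsep₂ : ∀ x' ∈ D.TX, D.eval f x' ≠ 0 → t - c' ≤ D.distX x₂ x') :
    |termP D L d j μ ν f x₁ - termP D L d j μ ν f x₂| ≤
      ā ^ 2 * c₁ * c₀ ^ 2 * R ^ 2 * (L ^ (S.k - j) * D.distX x₁ x₂) *
        (2 * (Real.exp (δ / 2 * c') * Real.exp (-(δ / 2 * t)) * D.supF f * Λ)) := by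
  have hL0 : 0 < L := lt_trans zero_lt_one hL
  obtain ⟨CH, hCH⟩ : ∃ CH : ℝ, CH = ā ^ 2 * c₁ * c₀ ^ 2 * R ^ 2 := ⟨_, rfl⟩
  have hCH0 : 0 ≤ CH := by rw [hCH]; positivity
  obtain ⟨Nρ, hNρ⟩ : ∃ Nρ : ℝ, Nρ = L ^ (S.k - j) * D.distX x₁ x₂ := ⟨_, rfl⟩
  have hNρ0 : 0 ≤ Nρ := by rw [hNρ]; exact mul_nonneg (pow_nonneg hL0.le _) (G.distX_nonneg _ _)
  have hW : ∀ x', |kerW D j μ ν x₁ x' - kerW D j μ ν x₂ x'| ≤ CH * Nρ *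
      (Real.exp (-(3 / 4 * δ * (L ^ (S.k - j) * D.distX x₁ x'))) +
        Real.exp (-(3 / 4 * δ * (L ^ (S.k - j) * D.distX x₂ x')))) := by
    intro x'
    have h := kerW_holder D L c₀ c₁ δ cc ā R Λ 1 d hL.le hc₀ hc₁ hδ ha hleaf hlip G Rw hj1 hj μ ν x₁ x₂ x'
      hne
    rw [Real.rpow_one] at h
    rw [hCH, hNρ]; exact h
  obtain ⟨Sf, hSf⟩ : ∃ Sf : ℝ,
      Sf = Real.exp (δ / 2 * c') * Real.exp (-(δ / 2 * t)) * D.supF f * Λ := ⟨_, rfl⟩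
  have hS₁ := supsum_le D L d δ cc c' t R Λ hL hδ G Rw N hj f x₁ hx₁ hsep₁
  have hS₂ := supsum_le D L d δ cc c' t R Λ hL hδ G Rw N hj f x₂ hx₂ hsep₂
  rw [← hSf] at hS₁ hS₂ ⊢
  rw [← hCH, ← hNρ]
  have hsub : termP D L d j μ ν f x₁ - termP D L d j μ ν f x₂ =
      ∑ x' ∈ D.TX, (L ^ (j * d))⁻¹ * (kerW D j μ ν x₁ x' - kerW D j μ ν x₂ x') * D.eval f x' := by
    unfold termP; rw [← Finset.sum_sub_distrib]; refine Finset.sum_congr rfl fun x' _ => ?_; ring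
  rw [hsub]
  calc |∑ x' ∈ D.TX, (L ^ (j * d))⁻¹ * (kerW D j μ ν x₁ x' - kerW D j μ ν x₂ x') * D.eval f x'|
      ≤ ∑ x' ∈ D.TX, |(L ^ (j * d))⁻¹ * (kerW D j μ ν x₁ x' - kerW D j μ ν x₂ x') * D.eval f x'| :=
        Finset.abs_sum_le_sum_abs _ _
    _ ≤ ∑ x' ∈ D.TX, CH * Nρ *
          ((L ^ (j * d))⁻¹ * Real.exp (-(3 / 4 * δ * (L ^ (S.k - j) * D.distX x₁ x'))) * |D.eval f x'| +
            (L ^ (j * d))⁻¹ * Real.exp (-(3 / 4 * δ * (L ^ (S.k - j) * D.distX x₂ x'))) *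
              |D.eval f x'|) := by
        refine Finset.sum_le_sum fun x' _ => ?_
        have hLjd : 0 ≤ (L ^ (j * d))⁻¹ := inv_nonneg.mpr (pow_nonneg hL0.le _)
        rw [abs_mul, abs_mul, abs_of_nonneg hLjd]
        calc (L ^ (j * d))⁻¹ * |kerW D j μ ν x₁ x' - kerW D j μ ν x₂ x'| * |D.eval f x'|
            ≤ (L ^ (j * d))⁻¹ * (CH * Nρ *
                (Real.exp (-(3 / 4 * δ * (L ^ (S.k - j) * D.distX x₁ x'))) +
                  Real.exp (-(3 / 4 * δ * (L ^ (S.k - j) * D.distX x₂ x'))))) * |D.eval f x'| :=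
              mul_le_mul_of_nonneg_right (mul_le_mul_of_nonneg_left (hW x') hLjd) (abs_nonneg _)
          _ = _ := by ring
    _ = CH * Nρ * (∑ x' ∈ D.TX, (L ^ (j * d))⁻¹ *
            Real.exp (-(3 / 4 * δ * (L ^ (S.k - j) * D.distX x₁ x'))) * |D.eval f x'| +
          ∑ x' ∈ D.TX, (L ^ (j * d))⁻¹ *
            Real.exp (-(3 / 4 * δ * (L ^ (S.k - j) * D.distX x₂ x'))) * |D.eval f x'|) := by
        rw [← Finset.mul_sum, Finset.sum_add_distrib]
    _ ≤ CH * Nρ * (Sf + Sf) := mul_le_mul_of_nonneg_left (add_le_add hS₁ hS₂) (mul_nonneg hCH0 hNρ0)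
    _ = CH * Nρ * (2 * Sf) := by ring

/-- **(1.135) ⟹ the sup bound** for a display with m ≥ 1 missing derivatives: with the separation hypothesis
(t − c′ ≤ |x − x′| whenever f(x′) ≠ 0), |(Ef)(x)| ≤ (c₀ + ā²c₀³R²)e^{(1/2)δc′}Λ/(L − 1) · e^{−(1/2)δt}|f| —
the sum over scales Σ_j (L^jη)^m ≤ 1/(L − 1) replaces the ε-dependent constant O(1) of the printed (1.137).
[cite: Balaban1984PropagatorsI, (1.110) p.35, (1.135)–(1.137) pp.39–40] -/
theorem sup_of_display135 (D : ScaleData S) (L : ℝ) (d m : ℕ) (c₀ δ cc ā R Λ c' t : ℝ) (hL : 1 < L)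
    (hc₀ : 0 ≤ c₀) (hδ : 0 ≤ δ) (hm : 1 ≤ m) (ha : ∀ j, |D.a j| ≤ ā) (h135 : Display135 D L d m)
    (hleaf : Leaf235to237 D L c₀ δ) (G : Geometry D L cc) (Rw : RowSums D L d (δ / 4) R Λ)
    (N : NormFacts D) (μ ν : D.Dir) (f : D.F) (x : D.X) (hx : x ∈ D.TX)
    (hsep : ∀ x' ∈ D.TX, D.eval f x' ≠ 0 → t - c' ≤ D.distX x x') :
    |D.E μ ν f x| ≤ (c₀ + ā ^ 2 * c₀ ^ 3 * R ^ 2) * Real.exp (δ / 2 * c') * Λ / (L - 1) *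
      Real.exp (-(δ / 2 * t)) * D.supF f := by
  have hL0 : 0 < L := lt_trans zero_lt_one hL
  obtain ⟨B, hB⟩ : ∃ B : ℝ, B = (c₀ + ā ^ 2 * c₀ ^ 3 * R ^ 2) *
      (Real.exp (δ / 2 * c') * Real.exp (-(δ / 2 * t)) * D.supF f * Λ) := ⟨_, rfl⟩
  have hB0 : 0 ≤ B := by
    rw [hB]; have := Rw.Λ_nonneg; have := N.sup_nonneg f; positivity
  have hT : ∀ j ∈ Finset.range S.k, |termP D L d j μ ν f x| ≤ B := by
    intro j hj; rw [hB]
    exact termP_abs_le D L d c₀ δ cc ā R Λ c' t hL hc₀ hδ ha hleaf G Rw N (Finset.mem_range.mp hj) μ ν f x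
      hx hsep
  rw [h135 μ ν f x hx]
  show |∑ j ∈ Finset.range S.k, (L ^ ((j : ℝ) - S.k)) ^ m * termP D L d j μ ν f x| ≤ _
  calc |∑ j ∈ Finset.range S.k, (L ^ ((j : ℝ) - S.k)) ^ m * termP D L d j μ ν f x|
      ≤ ∑ j ∈ Finset.range S.k, |(L ^ ((j : ℝ) - S.k)) ^ m * termP D L d j μ ν f x| :=
        Finset.abs_sum_le_sum_abs _ _
    _ ≤ ∑ j ∈ Finset.range S.k, (L ^ ((j : ℝ) - S.k)) ^ m * B := by
        refine Finset.sum_le_sum fun j hj => ?_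
        have hs0 : 0 ≤ (L ^ ((j : ℝ) - S.k)) ^ m := pow_nonneg (Real.rpow_nonneg hL0.le _) _
        rw [abs_mul, abs_of_nonneg hs0]
        exact mul_le_mul_of_nonneg_left (hT j hj) hs0
    _ = (∑ j ∈ Finset.range S.k, (L ^ ((j : ℝ) - S.k)) ^ m) * B := by rw [Finset.sum_mul]
    _ ≤ 1 / (L - 1) * B := mul_le_mul_of_nonneg_right (scale_sum_pow_le hL S.k m hm) hB0
    _ = _ := by rw [hB]; ring

/-- **(1.110) for one display** (x ∈ Δ̃(y), supp f ⊂ Δ̃(y′): the separation is |y − y′| − c(d) by `Geometry.cube_sep`),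
at rate ½δ with O(1) = (c₀ + ā²c₀³R²)e^{(1/2)δc}Λ/(L − 1).  [cite: Balaban1984PropagatorsI, (1.110) p.35] -/
theorem ineq110At_of_display135 (D : ScaleData S) (L : ℝ) (d m : ℕ) (c₀ δ cc ā R Λ : ℝ) (hL : 1 < L)
    (hc₀ : 0 ≤ c₀) (hδ : 0 ≤ δ) (hm : 1 ≤ m) (ha : ∀ j, |D.a j| ≤ ā) (h135 : Display135 D L d m)
    (hleaf : Leaf235to237 D L c₀ δ) (G : Geometry D L cc) (Rw : RowSums D L d (δ / 4) R Λ)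
    (N : NormFacts D) :
    Ineq110At D ((c₀ + ā ^ 2 * c₀ ^ 3 * R ^ 2) * Real.exp (δ / 2 * cc) * Λ / (L - 1)) (δ / 2) := by
  intro μ ν f x y y' hx hcube hsupp
  have hsep : ∀ x' ∈ D.TX, D.eval f x' ≠ 0 → S.dist y y' - cc ≤ D.distX x x' :=
    fun x' _ hfx' => G.cube_sep x x' y y' hcube (hsupp x' hfx')
  exact sup_of_display135 D L d m c₀ δ cc ā R Λ cc (S.dist y y') hL hc₀ hδ hm ha h135 hleaf G Rw N μ ν f x
    hx hsep

/-- **(1.110) at shifted points** x″, |x − x″| ≤ cb, x ∈ Δ̃(y) (separation |y − y′| − (c(d) + cb) by the triangle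
inequality), O(1) = (c₀ + ā²c₀³R²)e^{(1/2)δ(c+cb)}Λ/(L − 1).  [cite: Balaban1984PropagatorsI, (1.110) p.35] -/
theorem ineq110Near_of_display135 (D : ScaleData S) (L : ℝ) (d m : ℕ) (c₀ δ cc cb ā R Λ : ℝ) (hL : 1 < L)
    (hc₀ : 0 ≤ c₀) (hδ : 0 ≤ δ) (hm : 1 ≤ m) (ha : ∀ j, |D.a j| ≤ ā) (h135 : Display135 D L d m)
    (hleaf : Leaf235to237 D L c₀ δ) (G : Geometry D L cc) (G' : Geometry113 D L)
    (Rw : RowSums D L d (δ / 4) R Λ) (N : NormFacts D) :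
    Ineq110Near D ((c₀ + ā ^ 2 * c₀ ^ 3 * R ^ 2) * Real.exp (δ / 2 * (cc + cb)) * Λ / (L - 1)) (δ / 2)
      cb := by
  intro μ ν f x x'' y y' _ hx'' hcube hnear hsupp
  have hsep : ∀ x' ∈ D.TX, D.eval f x' ≠ 0 → S.dist y y' - (cc + cb) ≤ D.distX x'' x' := by
    intro x' _ hfx'
    have h1 := G.cube_sep x x' y y' hcube (hsupp x' hfx')
    have h2 := G'.triX x x'' x'
    linarith
  exact sup_of_display135 D L d m c₀ δ cc ā R Λ (cc + cb) (S.dist y y') hL hc₀ hδ hm ha h135 hleaf G Rw N μ ν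
    f x'' hx'' hsep

/-- **(1.135) ⟹ (1.111) (pair form) for one display with ONE missing derivative** (m = 1), 0 ≤ α < 1, at rate ½δ
with O(1)(α) = 2((c₀ + ā²c₀³R²) + ā²c₁c₀²R²)e^{(1/2)δ(c+1)}Λ/(L^{1−α} − 1) — «O(1) → ∞ if α → 1» (p. 36, l. 1).
Per scale j, with s = L^jη and ρ = |x₁ − x₂| ≤ 1: CRUDE scales (s ≤ ρ): |T_j(x₁)| + |T_j(x₂)| and s ≤ ρ^α s^{1−α};
FINE scales (ρ ≤ s, j ≥ 1 by the lattice separation ρ ≥ η): the kernel Lipschitz bound gives s·(ρ/s) = ρ ≤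
ρ^α s^{1−α}; then Σ_j s^{1−α} ≤ 1/(L^{1−α} − 1) — the printed precedent is [2] (2.38)–(2.39), p. 582:
«≤ O(1) Σ_{j=0}^{k−1} (L^jη)^{1−α}‖f‖_∞ ≤ c′₁‖f‖_∞, (2.39)».
[cite: Balaban1984PropagatorsI, (1.111) p.35, pp.39–40; Balaban1983RegularityDecay, (2.38)–(2.39) p.582] -/
theorem ineq111Pair_of_display135 (D : ScaleData S) (L : ℝ) (d : ℕ) (c₀ c₁ δ cc ā R Λ α : ℝ) (hL : 1 < L)
    (hc₀ : 0 ≤ c₀) (hc₁ : 0 ≤ c₁) (hδ : 0 ≤ δ) (hα0 : 0 ≤ α) (hα1 : α < 1) (ha : ∀ j, |D.a j| ≤ ā)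
    (h135 : Display135 D L d 1) (hleaf : Leaf235to237 D L c₀ δ) (hlip : Leaf236 D L 1 c₁ δ)
    (G : Geometry D L cc) (G' : Geometry113 D L) (Rw : RowSums D L d (δ / 4) R Λ) (N : NormFacts D) :
    Ineq111Pair D α (2 * ((c₀ + ā ^ 2 * c₀ ^ 3 * R ^ 2) + ā ^ 2 * c₁ * c₀ ^ 2 * R ^ 2) *
      Real.exp (δ / 2 * (cc + 1)) * Λ / (L ^ (1 - α) - 1)) (δ / 2) := by
  intro μ ν f x₁ x₂ y y' hx₁ hx₂ hne hρ1 hcube hsupp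
  have hL0 : 0 < L := lt_trans zero_lt_one hL
  have hsep₁ : ∀ x' ∈ D.TX, D.eval f x' ≠ 0 → S.dist y y' - (cc + 1) ≤ D.distX x₁ x' := by
    intro x' _ hfx'
    have h := G.cube_sep x₁ x' y y' hcube (hsupp x' hfx')
    linarith
  have hsep₂ : ∀ x' ∈ D.TX, D.eval f x' ≠ 0 → S.dist y y' - (cc + 1) ≤ D.distX x₂ x' := by
    intro x' _ hfx'
    have h := G.cube_sep x₁ x' y y' hcube (hsupp x' hfx')
    have htri := G'.triX x₁ x₂ x'
    linarith
  obtain ⟨CW, hCW⟩ : ∃ CW : ℝ, CW = c₀ + ā ^ 2 * c₀ ^ 3 * R ^ 2 := ⟨_, rfl⟩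
  obtain ⟨CH, hCH⟩ : ∃ CH : ℝ, CH = ā ^ 2 * c₁ * c₀ ^ 2 * R ^ 2 := ⟨_, rfl⟩
  obtain ⟨Sf, hSf⟩ : ∃ Sf : ℝ,
      Sf = Real.exp (δ / 2 * (cc + 1)) * Real.exp (-(δ / 2 * S.dist y y')) * D.supF f * Λ := ⟨_, rfl⟩
  have hΛ0 := Rw.Λ_nonneg
  have hsup0 := N.sup_nonneg f
  have hCW0 : 0 ≤ CW := by rw [hCW]; positivity
  have hCH0 : 0 ≤ CH := by rw [hCH]; positivity
  have hSf0 : 0 ≤ Sf := by rw [hSf]; positivity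
  have hρ0 : 0 ≤ D.distX x₁ x₂ := G.distX_nonneg x₁ x₂
  have hρα : 0 ≤ D.distX x₁ x₂ ^ α := Real.rpow_nonneg hρ0 α
  have hgap : 0 < L ^ (1 - α) - 1 := by
    have : 1 < L ^ (1 - α) := Real.one_lt_rpow hL (by linarith)
    linarith
  have hginv0 : 0 ≤ 1 / (L ^ (1 - α) - 1) := by positivity
  have hT₁ : ∀ j, j < S.k → |termP D L d j μ ν f x₁| ≤ CW * Sf := by
    intro j hj; rw [hCW, hSf]
    exact termP_abs_le D L d c₀ δ cc ā R Λ (cc + 1) (S.dist y y') hL hc₀ hδ ha hleaf G Rw N hj μ ν f x₁ hx₁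
      hsep₁
  have hT₂ : ∀ j, j < S.k → |termP D L d j μ ν f x₂| ≤ CW * Sf := by
    intro j hj; rw [hCW, hSf]
    exact termP_abs_le D L d c₀ δ cc ā R Λ (cc + 1) (S.dist y y') hL hc₀ hδ ha hleaf G Rw N hj μ ν f x₂ hx₂
      hsep₂
  -- per-scale bound: (L^jη)|T_j(x₁) − T_j(x₂)| ≤ 2(CW + CH)Sf · ρ^α (L^jη)^{1−α}
  have hper : ∀ j ∈ Finset.range S.k,
      |L ^ ((j : ℝ) - S.k) * (termP D L d j μ ν f x₁ - termP D L d j μ ν f x₂)| ≤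
        2 * (CW + CH) * Sf * (D.distX x₁ x₂ ^ α * (L ^ ((j : ℝ) - S.k)) ^ (1 - α)) := by
    intro j hj
    have hjk := Finset.mem_range.mp hj
    have hs : 0 < L ^ ((j : ℝ) - S.k) := Real.rpow_pos_of_pos hL0 _
    have hsα : 0 ≤ (L ^ ((j : ℝ) - S.k)) ^ (1 - α) := Real.rpow_nonneg hs.le _
    have hsN : L ^ ((j : ℝ) - S.k) * L ^ (S.k - j) = 1 := scale_cancel hL0 hjk.le
    rw [abs_mul, abs_of_pos hs]
    rcases le_or_gt 1 (L ^ (S.k - j) * D.distX x₁ x₂) with hcr | hfi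
    · -- crude scale
      have hsρ : L ^ ((j : ℝ) - S.k) ≤ D.distX x₁ x₂ := by
        have h1 : L ^ ((j : ℝ) - S.k) * 1 ≤ L ^ ((j : ℝ) - S.k) * (L ^ (S.k - j) * D.distX x₁ x₂) :=
          mul_le_mul_of_nonneg_left hcr hs.le
        calc L ^ ((j : ℝ) - S.k) = L ^ ((j : ℝ) - S.k) * 1 := (mul_one _).symm
          _ ≤ L ^ ((j : ℝ) - S.k) * (L ^ (S.k - j) * D.distX x₁ x₂) := h1
          _ = L ^ ((j : ℝ) - S.k) * L ^ (S.k - j) * D.distX x₁ x₂ := by ring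
          _ = D.distX x₁ x₂ := by rw [hsN, one_mul]
      have hsc := crude_scale_le hs hα0 hsρ
      have hdiff : |termP D L d j μ ν f x₁ - termP D L d j μ ν f x₂| ≤ 2 * CW * Sf := by
        calc |termP D L d j μ ν f x₁ - termP D L d j μ ν f x₂|
            ≤ |termP D L d j μ ν f x₁| + |termP D L d j μ ν f x₂| := abs_sub _ _
          _ ≤ CW * Sf + CW * Sf := add_le_add (hT₁ j hjk) (hT₂ j hjk)
          _ = 2 * CW * Sf := by ring
      calc L ^ ((j : ℝ) - S.k) * |termP D L d j μ ν f x₁ - termP D L d j μ ν f x₂|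
          ≤ (D.distX x₁ x₂ ^ α * (L ^ ((j : ℝ) - S.k)) ^ (1 - α)) * (2 * CW * Sf) :=
            mul_le_mul hsc hdiff (abs_nonneg _) (mul_nonneg hρα hsα)
        _ ≤ (D.distX x₁ x₂ ^ α * (L ^ ((j : ℝ) - S.k)) ^ (1 - α)) * (2 * (CW + CH) * Sf) := by
            refine mul_le_mul_of_nonneg_left ?_ (mul_nonneg hρα hsα)
            nlinarith [mul_nonneg hCH0 hSf0]
        _ = _ := by ring
    · -- fine scale: j ≥ 1 by the lattice separation, then the kernel Lipschitz bound
      have hj1 : 1 ≤ j := by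
        by_contra h0
        have h0' : j = 0 := by omega
        subst h0'
        have hsep := G'.lattice_sep x₁ x₂ hne
        simp only [Nat.sub_zero] at hfi
        linarith
      have hdiff := termP_diff_le D L d c₀ c₁ δ cc ā R Λ (cc + 1) (S.dist y y') hL hc₀ hc₁ hδ ha hleaf hlip
        G Rw N hj1 hjk μ ν f x₁ x₂ hx₁ hx₂ hne hsep₁ hsep₂
      rw [← hCH, ← hSf] at hdiff
      have hsc := fine_scale_le (α := α) hs hρ0 hsN hα1.le hfi.le
      calc L ^ ((j : ℝ) - S.k) * |termP D L d j μ ν f x₁ - termP D L d j μ ν f x₂|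
          ≤ L ^ ((j : ℝ) - S.k) * (CH * (L ^ (S.k - j) * D.distX x₁ x₂) * (2 * Sf)) :=
            mul_le_mul_of_nonneg_left hdiff hs.le
        _ = (L ^ ((j : ℝ) - S.k) * (L ^ (S.k - j) * D.distX x₁ x₂)) * (2 * CH * Sf) := by ring
        _ ≤ (D.distX x₁ x₂ ^ α * (L ^ ((j : ℝ) - S.k)) ^ (1 - α)) * (2 * CH * Sf) :=
            mul_le_mul_of_nonneg_right hsc (by positivity)
        _ ≤ (D.distX x₁ x₂ ^ α * (L ^ ((j : ℝ) - S.k)) ^ (1 - α)) * (2 * (CW + CH) * Sf) := by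
            refine mul_le_mul_of_nonneg_left ?_ (mul_nonneg hρα hsα)
            nlinarith [mul_nonneg hCW0 hSf0]
        _ = _ := by ring
  have hE : D.E μ ν f x₁ - D.E μ ν f x₂ =
      ∑ j ∈ Finset.range S.k, L ^ ((j : ℝ) - S.k) * (termP D L d j μ ν f x₁ - termP D L d j μ ν f x₂) := by
    rw [h135 μ ν f x₁ hx₁, h135 μ ν f x₂ hx₂, ← Finset.sum_sub_distrib]
    refine Finset.sum_congr rfl fun j _ => ?_
    simp only [pow_one, termP]; ring
  have hsum : ∑ j ∈ Finset.range S.k, (L ^ ((j : ℝ) - S.k)) ^ (1 - α) ≤ 1 / (L ^ (1 - α) - 1) :=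
    B5FromB4.scale_sum_bound L (1 - α) hL (by linarith) S.k
  refine ⟨?_, ?_⟩
  · rw [hE]
    calc |∑ j ∈ Finset.range S.k, L ^ ((j : ℝ) - S.k) * (termP D L d j μ ν f x₁ - termP D L d j μ ν f x₂)|
        ≤ ∑ j ∈ Finset.range S.k,
            |L ^ ((j : ℝ) - S.k) * (termP D L d j μ ν f x₁ - termP D L d j μ ν f x₂)| :=
          Finset.abs_sum_le_sum_abs _ _
      _ ≤ ∑ j ∈ Finset.range S.k,
            2 * (CW + CH) * Sf * (D.distX x₁ x₂ ^ α * (L ^ ((j : ℝ) - S.k)) ^ (1 - α)) :=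
          Finset.sum_le_sum hper
      _ = 2 * (CW + CH) * Sf * D.distX x₁ x₂ ^ α *
            ∑ j ∈ Finset.range S.k, (L ^ ((j : ℝ) - S.k)) ^ (1 - α) := by
          rw [Finset.mul_sum]; refine Finset.sum_congr rfl fun j _ => ?_; ring
      _ ≤ 2 * (CW + CH) * Sf * D.distX x₁ x₂ ^ α * (1 / (L ^ (1 - α) - 1)) :=
          mul_le_mul_of_nonneg_left hsum (by positivity)
      _ = _ := by rw [hCW, hCH, hSf]; ring
  · have h := sup_of_display135 D L d 1 c₀ δ cc ā R Λ (cc + 1) (S.dist y y') hL hc₀ hδ le_rfl ha h135 hleaf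
      G Rw N μ ν f x₂ hx₂ hsep₂
    have hginv : 1 / (L - 1) ≤ 1 / (L ^ (1 - α) - 1) := inv_gap_le_inv_gap_rpow hL hα0 hα1
    calc |D.E μ ν f x₂| ≤ (c₀ + ā ^ 2 * c₀ ^ 3 * R ^ 2) * Real.exp (δ / 2 * (cc + 1)) * Λ / (L - 1) *
          Real.exp (-(δ / 2 * S.dist y y')) * D.supF f := h
      _ = CW * Sf * (1 / (L - 1)) := by rw [hCW, hSf]; ring
      _ ≤ CW * Sf * (1 / (L ^ (1 - α) - 1)) := mul_le_mul_of_nonneg_left hginv (mul_nonneg hCW0 hSf0)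
      _ ≤ 2 * (CW + CH) * Sf * (1 / (L ^ (1 - α) - 1)) := by
          refine mul_le_mul_of_nonneg_right ?_ hginv0
          nlinarith [mul_nonneg hCW0 hSf0, mul_nonneg hCH0 hSf0]
      _ = _ := by rw [hCW, hCH, hSf]; ring


/-- **(1.111) for one display from (1.135)**: the pair bounds of `ineq111Pair_of_display135` and the sup bound
of `sup_of_display135` at the cube point itself (constant enlarged to the common O(1)(α)).
[cite: Balaban1984PropagatorsI, (1.111) p.35, p.36 l.1, (1.135) p.39] -/
theorem ineq111At_of_display135 (D : ScaleData S) (L : ℝ) (d : ℕ) (c₀ c₁ δ cc ā R Λ α : ℝ) (hL : 1 < L)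
    (hc₀ : 0 ≤ c₀) (hc₁ : 0 ≤ c₁) (hδ : 0 ≤ δ) (hα0 : 0 ≤ α) (hα1 : α < 1) (ha : ∀ j, |D.a j| ≤ ā)
    (h135 : Display135 D L d 1) (hleaf : Leaf235to237 D L c₀ δ) (hlip : Leaf236 D L 1 c₁ δ)
    (G : Geometry D L cc) (G' : Geometry113 D L) (Rw : RowSums D L d (δ / 4) R Λ) (N : NormFacts D) :
    Ineq111At D α (2 * ((c₀ + ā ^ 2 * c₀ ^ 3 * R ^ 2) + ā ^ 2 * c₁ * c₀ ^ 2 * R ^ 2) *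
      Real.exp (δ / 2 * (cc + 1)) * Λ / (L ^ (1 - α) - 1)) (δ / 2) := by
  intro μ ν f x₁ y y' hx₁ hcube hsupp
  refine ⟨?_, fun x₂ hx₂ hne hρ1 => ineq111Pair_of_display135 D L d c₀ c₁ δ cc ā R Λ α hL hc₀ hc₁ hδ hα0
    hα1 ha h135 hleaf hlip G G' Rw N μ ν f x₁ x₂ y y' hx₁ hx₂ hne hρ1 hcube hsupp⟩
  have hsep₁ : ∀ x' ∈ D.TX, D.eval f x' ≠ 0 → S.dist y y' - (cc + 1) ≤ D.distX x₁ x' := by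
    intro x' _ hfx'
    have h := G.cube_sep x₁ x' y y' hcube (hsupp x' hfx')
    linarith
  obtain ⟨CW, hCW⟩ : ∃ CW : ℝ, CW = c₀ + ā ^ 2 * c₀ ^ 3 * R ^ 2 := ⟨_, rfl⟩
  obtain ⟨CH, hCH⟩ : ∃ CH : ℝ, CH = ā ^ 2 * c₁ * c₀ ^ 2 * R ^ 2 := ⟨_, rfl⟩
  obtain ⟨Sf, hSf⟩ : ∃ Sf : ℝ,
      Sf = Real.exp (δ / 2 * (cc + 1)) * Real.exp (-(δ / 2 * S.dist y y')) * D.supF f * Λ := ⟨_, rfl⟩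
  have hΛ0 := Rw.Λ_nonneg
  have hsup0 := N.sup_nonneg f
  have hCW0 : 0 ≤ CW := by rw [hCW]; positivity
  have hCH0 : 0 ≤ CH := by rw [hCH]; positivity
  have hSf0 : 0 ≤ Sf := by rw [hSf]; positivity
  have hgap : 0 < L ^ (1 - α) - 1 := by
    have : 1 < L ^ (1 - α) := Real.one_lt_rpow hL (by linarith)
    linarith
  have hginv0 : 0 ≤ 1 / (L ^ (1 - α) - 1) := by positivity
  have hginv : 1 / (L - 1) ≤ 1 / (L ^ (1 - α) - 1) := inv_gap_le_inv_gap_rpow hL hα0 hα1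
  have h := sup_of_display135 D L d 1 c₀ δ cc ā R Λ (cc + 1) (S.dist y y') hL hc₀ hδ le_rfl ha h135 hleaf
    G Rw N μ ν f x₁ hx₁ hsep₁
  calc |D.E μ ν f x₁| ≤ (c₀ + ā ^ 2 * c₀ ^ 3 * R ^ 2) * Real.exp (δ / 2 * (cc + 1)) * Λ / (L - 1) *
        Real.exp (-(δ / 2 * S.dist y y')) * D.supF f := h
    _ = CW * Sf * (1 / (L - 1)) := by rw [hCW, hSf]; ring
    _ ≤ CW * Sf * (1 / (L ^ (1 - α) - 1)) := mul_le_mul_of_nonneg_left hginv (mul_nonneg hCW0 hSf0)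
    _ ≤ 2 * (CW + CH) * Sf * (1 / (L ^ (1 - α) - 1)) := by
        refine mul_le_mul_of_nonneg_right ?_ hginv0
        nlinarith [mul_nonneg hCW0 hSf0, mul_nonneg hCH0 hSf0]
    _ = _ := by rw [hCW, hCH, hSf]; ring

/-! ## §4. The entries of `B5.Setting` / `GpHolder`, the leaves from Lemma 2.4, and the family assembly -/

/-- **Sup entry |(G′∇*J)(x)| of (1.110)** from the scalar bound `Ineq110At` on the display of G′_k∂*_ν and the
dictionaries (constant d·C: the sum over ν).  [cite: Balaban1984PropagatorsI, (1.110) p.35] -/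
theorem supEntry2_of_ineq110 (D : ScaleData S) (P : GpData D) (F : B5FromB4.GpHolder S) (dN : ℕ) (C δ : ℝ)
    (hC : 0 ≤ C) (h110 : Ineq110At (dataR D P) C δ) (X : Dict137 D dN) (XG : DictGp D P F dN) :
    B5FromB4.SupEntry S 2 (dN * C) δ := by
  intro J y y' hJ
  have hb : ∀ (ν : D.Dir) (x : D.X), x ∈ D.TX → D.cube x y →
      |P.E1 ν (D.comp J ν) x| ≤ C * Real.exp (-(δ * S.dist y y')) * S.supNorm J := by
    intro ν x hx hcube
    have h := h110 ν ν (D.comp J ν) x y y' hx hcube (X.supp J y' ν hJ)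
    calc |P.E1 ν (D.comp J ν) x| ≤ C * Real.exp (-(δ * S.dist y y')) * D.supF (D.comp J ν) := h
      _ ≤ C * Real.exp (-(δ * S.dist y y')) * S.supNorm J :=
          mul_le_mul_of_nonneg_left (X.sup_le J ν) (mul_nonneg hC (Real.exp_nonneg _))
  calc S.e 2 J y ≤ dN * (C * Real.exp (-(δ * S.dist y y')) * S.supNorm J) := XG.e2_le J y _ hb
    _ = dN * C * Real.exp (-(δ * S.dist y y')) * S.supNorm J := by ring

/-- **Sup entry |(ΔG′J)(x)| of (1.110)** from ΔG′_k = I − a_kQ′*_kQ′_kG′_k (`LaplaceLeaf`), the scalar bound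
`Ineq110Near` on the display of G′_k at the points x″ of the averaging block of x, and |J_μ(x)| ≤ |J| with
x ∈ Δ̃(y) ∩ Δ̃(y′) ⇒ |y − y′| ≤ c(d) (`Geometry.cube_near`): constant d(e^{δc} + a·C).
[cite: Balaban1984PropagatorsI, (1.110) p.35, Sect. B] -/
theorem supEntry3_of_ineq110Near (D : ScaleData S) (P : GpData D) (F : B5FromB4.GpHolder S) (dN : ℕ)
    (C δ cc cb aK L : ℝ) (hC : 0 ≤ C) (hδ : 0 ≤ δ) (haK : 0 ≤ aK) (hnear : Ineq110Near (dataZ D P) C δ cb)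
    (Lap : LaplaceLeaf D P aK cb) (G : Geometry D L cc) (X : Dict137 D dN) (XG : DictGp D P F dN)
    (N : NormFacts D) :
    B5FromB4.SupEntry S 3 (dN * (Real.exp (δ * cc) + aK * C)) δ := by
  intro J y y' hJ
  have hb : ∀ (μ : D.Dir) (x : D.X), x ∈ D.TX → D.cube x y →
      |P.EL (D.comp J μ) x| ≤ (Real.exp (δ * cc) + aK * C) * Real.exp (-(δ * S.dist y y')) * S.supNorm J := by
    intro μ x hx hcube
    have hsuppf : suppF D (D.comp J μ) y' := X.supp J y' μ hJ
    have hM : 0 ≤ S.supNorm J := (N.sup_nonneg _).trans (X.sup_le J μ)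
    have h1 : |D.eval (D.comp J μ) x| ≤ Real.exp (δ * cc) * Real.exp (-(δ * S.dist y y')) * S.supNorm J := by
      by_cases hz : D.eval (D.comp J μ) x = 0
      · rw [hz, abs_zero]; positivity
      · have hnear' : S.dist y y' ≤ cc := G.cube_near x y y' hcube (hsuppf x hz)
        have hexp : 1 ≤ Real.exp (δ * cc) * Real.exp (-(δ * S.dist y y')) := by
          rw [← Real.exp_add]
          apply Real.one_le_exp
          nlinarith
        calc |D.eval (D.comp J μ) x| ≤ S.supNorm J := (N.sup_le _ x).trans (X.sup_le J μ)
          _ = 1 * S.supNorm J := (one_mul _).symm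
          _ ≤ (Real.exp (δ * cc) * Real.exp (-(δ * S.dist y y'))) * S.supNorm J :=
              mul_le_mul_of_nonneg_right hexp hM
          _ = _ := by ring
    have h2 : ∑ x'' ∈ D.TX, P.w x x'' * |P.E0 (D.comp J μ) x''| ≤
        C * Real.exp (-(δ * S.dist y y')) * S.supNorm J := by
      have key : ∀ x'' ∈ D.TX, P.w x x'' * |P.E0 (D.comp J μ) x''| ≤
          P.w x x'' * (C * Real.exp (-(δ * S.dist y y')) * S.supNorm J) := by
        intro x'' hx''
        by_cases hw : P.w x x'' = 0
        · rw [hw, zero_mul, zero_mul]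
        · refine mul_le_mul_of_nonneg_left ?_ (Lap.w_nonneg x x'')
          have h := hnear μ μ (D.comp J μ) x x'' y y' hx hx'' hcube (Lap.w_near x x'' hw) hsuppf
          calc |P.E0 (D.comp J μ) x''| ≤ C * Real.exp (-(δ * S.dist y y')) * D.supF (D.comp J μ) := h
            _ ≤ _ := mul_le_mul_of_nonneg_left (X.sup_le J μ) (mul_nonneg hC (Real.exp_nonneg _))
      calc ∑ x'' ∈ D.TX, P.w x x'' * |P.E0 (D.comp J μ) x''|
          ≤ ∑ x'' ∈ D.TX, P.w x x'' * (C * Real.exp (-(δ * S.dist y y')) * S.supNorm J) :=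
            Finset.sum_le_sum key
        _ = (∑ x'' ∈ D.TX, P.w x x'') * (C * Real.exp (-(δ * S.dist y y')) * S.supNorm J) := by
            rw [Finset.sum_mul]
        _ ≤ 1 * (C * Real.exp (-(δ * S.dist y y')) * S.supNorm J) :=
            mul_le_mul_of_nonneg_right (Lap.w_sum x hx) (by positivity)
        _ = _ := one_mul _
    calc |P.EL (D.comp J μ) x|
        ≤ |D.eval (D.comp J μ) x| + aK * ∑ x'' ∈ D.TX, P.w x x'' * |P.E0 (D.comp J μ) x''| :=
          Lap.lap _ x hx
      _ ≤ Real.exp (δ * cc) * Real.exp (-(δ * S.dist y y')) * S.supNorm J +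
            aK * (C * Real.exp (-(δ * S.dist y y')) * S.supNorm J) :=
          add_le_add h1 (mul_le_mul_of_nonneg_left h2 haK)
      _ = _ := by ring
  calc S.e 3 J y ≤ dN * ((Real.exp (δ * cc) + aK * C) * Real.exp (-(δ * S.dist y y')) * S.supNorm J) :=
      XG.e3_le J y _ hb
    _ = _ := by ring

/-- **Hölder entry ‖ζG′∇*J‖_α of (1.111)** from the scalar bound `Ineq111At` on the display of G′_k∂*_ν and the
dictionaries (constant d·C).  [cite: Balaban1984PropagatorsI, (1.111) p.35] -/
theorem hS_of_ineq111 (D : ScaleData S) (P : GpData D) (F : B5FromB4.GpHolder S) (dN : ℕ) (α C δ L cc : ℝ)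
    (hC : 0 ≤ C) (h111 : Ineq111At (dataR D P) α C δ) (G : Geometry D L cc) (X : Dict137 D dN)
    (XG : DictGp D P F dN) (Sg : B5FromB4.ModelSigns S) (J : S.Loc) (ζ : S.Cut) (y y' : S.Site)
    (hζ : S.cutIn ζ y) (hJ : S.suppIn J y') :
    F.hS J α ζ ≤ dN * C * Real.exp (-(δ * S.dist y y')) * S.cutH α ζ * S.supNorm J := by
  have hCe : 0 ≤ C * Real.exp (-(δ * S.dist y y')) := mul_nonneg hC (Real.exp_nonneg _)
  have hb : ∀ (ν : D.Dir) (x₁ : D.X), x₁ ∈ D.TX → D.cube x₁ y →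
      |P.E1 ν (D.comp J ν) x₁| ≤ C * Real.exp (-(δ * S.dist y y')) * S.supNorm J ∧
      ∀ x₂ : D.X, x₂ ∈ D.TX → x₁ ≠ x₂ → D.distX x₁ x₂ ≤ 1 →
        |P.E1 ν (D.comp J ν) x₁ - P.E1 ν (D.comp J ν) x₂| ≤
            C * Real.exp (-(δ * S.dist y y')) * S.supNorm J * D.distX x₁ x₂ ^ α ∧
          |P.E1 ν (D.comp J ν) x₂| ≤ C * Real.exp (-(δ * S.dist y y')) * S.supNorm J := by
    intro ν x₁ hx₁ hcube
    have h := h111 ν ν (D.comp J ν) x₁ y y' hx₁ hcube (X.supp J y' ν hJ)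
    refine ⟨h.1.trans (mul_le_mul_of_nonneg_left (X.sup_le J ν) hCe), fun x₂ hx₂ hne hρ => ?_⟩
    have h₂ := h.2 x₂ hx₂ hne hρ
    have hρα : 0 ≤ D.distX x₁ x₂ ^ α := Real.rpow_nonneg (G.distX_nonneg x₁ x₂) α
    refine ⟨h₂.1.trans ?_, h₂.2.trans ?_⟩
    · exact mul_le_mul_of_nonneg_right (mul_le_mul_of_nonneg_left (X.sup_le J ν) hCe) hρα
    · exact mul_le_mul_of_nonneg_left (X.sup_le J ν) hCe
  have h := XG.hS_le J α ζ y _ hζ (mul_nonneg hCe (Sg.supNorm_nonneg J)) hb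
  calc F.hS J α ζ ≤ dN * S.cutH α ζ * (C * Real.exp (-(δ * S.dist y y')) * S.supNorm J) := h
    _ = _ := by ring

/-- **Lemma 2.4 (2.35)/(2.37) ⟹ the leaf estimates on the kernels of (1.135) for G′_k∂*_ν and G′_k** through
`Dict24Gp`: `Leaf235to237` for both swapped carriers with constant 4c₀e^{δ₀s₀} (as `B5Ineq137.leaf_of_lemma24`),
and the Lipschitz leaf `Leaf236 (dataR D P) L 1 (c₀ + pL·c₀e^{δ₀pL}) δ₀` for the kernel G′_jQ′*_j — near pairs
(L^{k−j}|x₁ − x₂| ≤ 1) by the mean-value field and (2.35) for the derivative kernel, far pairs by (2.35) twice.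
[cite: Balaban1983RegularityDecay, Lemma 2.4 (2.35)/(2.37) p.582; Balaban1984PropagatorsI, p.39] -/
theorem leafGp_of_lemma24 {I₂₄ : Type} {fam₂₄ : I₂₄ → B4.ScaleSetting} {c₀ δ₀ : ℝ} (hc₀ : 0 < c₀)
    (hδ₀ : 0 < δ₀)
    (H24 : ∀ i : I₂₄, (fam₂₄ i).rectLarge →
      (∀ (x : (fam₂₄ i).SiteF) (y : (fam₂₄ i).SiteU),
          (fam₂₄ i).kerGQ x y ≤ c₀ * Real.exp (-(δ₀ * (fam₂₄ i).distF x y))) ∧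
      (∀ (μ : (fam₂₄ i).Dir) (x : (fam₂₄ i).SiteF) (y : (fam₂₄ i).SiteU),
          (fam₂₄ i).kerDGQ μ x y ≤ c₀ * Real.exp (-(δ₀ * (fam₂₄ i).distF x y))) ∧
      (∀ y y' : (fam₂₄ i).SiteU, (fam₂₄ i).kerC y y' ≤ c₀ * Real.exp (-(δ₀ * (fam₂₄ i).distU y y'))))
    (D : ScaleData S) (P : GpData D) (L s₀ pL cc : ℝ) (hL : 1 ≤ L) (hs₀ : 0 ≤ s₀) (hpL : 0 ≤ pL)
    (G : Geometry D L cc) (Dc : Dict24Gp fam₂₄ D P L s₀ pL) :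
    Leaf235to237 (dataR D P) L (4 * c₀ * Real.exp (δ₀ * s₀)) δ₀ ∧
      Leaf235to237 (dataZ D P) L (4 * c₀ * Real.exp (δ₀ * s₀)) δ₀ ∧
      Leaf236 (dataR D P) L 1 (c₀ + pL * c₀ * Real.exp (δ₀ * pL)) δ₀ := by
  have hL0 : 0 ≤ L := le_trans zero_le_one hL
  have hbig : c₀ ≤ 4 * c₀ * Real.exp (δ₀ * s₀) := by
    have h1 : 1 ≤ Real.exp (δ₀ * s₀) := Real.one_le_exp (by positivity)
    nlinarith
  obtain ⟨i₀, hrect₀, P₀, P₁, hcard₀, hcard₁, hK00, hK0R, hdist₀, hdist₁⟩ := Dc.zero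
  obtain ⟨-, -, hC₀⟩ := H24 i₀ hrect₀
  have zero_bound : ∀ (Q : Finset ((fam₂₄ i₀).SiteU × (fam₂₄ i₀).SiteU)) (v t : ℝ), Q.card ≤ 4 →
      |v| ≤ ∑ p ∈ Q, (fam₂₄ i₀).kerC p.1 p.2 → (∀ p ∈ Q, t - s₀ ≤ (fam₂₄ i₀).distU p.1 p.2) →
      |v| ≤ 4 * c₀ * Real.exp (δ₀ * s₀) * Real.exp (-(δ₀ * t)) := by
    intro Q v t hcard hv hdist
    calc |v| ≤ ∑ p ∈ Q, (fam₂₄ i₀).kerC p.1 p.2 := hv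
      _ ≤ ∑ p ∈ Q, c₀ * Real.exp (δ₀ * s₀) * Real.exp (-(δ₀ * t)) := by
          refine Finset.sum_le_sum fun p hp => (hC₀ p.1 p.2).trans ?_
          rw [mul_assoc]
          exact mul_le_mul_of_nonneg_left (B5FromB4.exp_shift hδ₀.le (hdist p hp)) hc₀.le
      _ = Q.card * (c₀ * Real.exp (δ₀ * s₀) * Real.exp (-(δ₀ * t))) := by
          rw [Finset.sum_const, nsmul_eq_mul]
      _ ≤ 4 * (c₀ * Real.exp (δ₀ * s₀) * Real.exp (-(δ₀ * t))) := by
          refine mul_le_mul_of_nonneg_right ?_ (by positivity)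
          exact_mod_cast hcard
      _ = _ := by ring
  have mid_bound : ∀ j, 1 ≤ j → j < S.k →
      (∀ (x : D.X) (y : D.U),
          |P.K1n j x y| ≤ 4 * c₀ * Real.exp (δ₀ * s₀) * Real.exp (-(δ₀ * D.dXU j x y))) ∧
      (∀ (y y' : D.U), |D.K2 j y y'| ≤ 4 * c₀ * Real.exp (δ₀ * s₀) * Real.exp (-(δ₀ * D.dUU j y y'))) ∧
      (∀ (ν : D.Dir) (y : D.U) (x' : D.X),
          |D.K3 j ν y x'| ≤ 4 * c₀ * Real.exp (δ₀ * s₀) * Real.exp (-(δ₀ * D.dXU j x' y))) ∧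
      (∀ (y : D.U) (x' : D.X),
          |P.K3n j y x'| ≤ 4 * c₀ * Real.exp (δ₀ * s₀) * Real.exp (-(δ₀ * D.dXU j x' y))) ∧
      (∀ (x₁ x₂ : D.X) (y : D.U), |P.K1n j x₁ y - P.K1n j x₂ y| ≤
          (c₀ + pL * c₀ * Real.exp (δ₀ * pL)) * (L ^ (S.k - j) * D.distX x₁ x₂) ^ (1 : ℝ) *
            (Real.exp (-(δ₀ * D.dXU j x₁ y)) + Real.exp (-(δ₀ * D.dXU j x₂ y)))) := by
    intro j hj1 hjk
    obtain ⟨i, hrect, σ, τ, dir, hK1, hK3n, hK3, hK2, hdF, hdU, hlip⟩ := Dc.mid j hj1 hjk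
    obtain ⟨hGQ, hDGQ, hC⟩ := H24 i hrect
    have hK1' : ∀ x y, |P.K1n j x y| ≤ c₀ * Real.exp (-(δ₀ * D.dXU j x y)) := fun x y => by
      calc |P.K1n j x y| ≤ (fam₂₄ i).kerGQ (σ x) (τ y) := hK1 x y
        _ ≤ c₀ * Real.exp (-(δ₀ * (fam₂₄ i).distF (σ x) (τ y))) := hGQ (σ x) (τ y)
        _ = c₀ * Real.exp (-(δ₀ * D.dXU j x y)) := by rw [hdF x y]
    refine ⟨fun x y => (hK1' x y).trans (mul_le_mul_of_nonneg_right hbig (Real.exp_nonneg _)),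
      fun y y' => ?_, fun ν y x' => ?_, fun y x' => ?_, fun x₁ x₂ y => ?_⟩
    · calc |D.K2 j y y'| ≤ (fam₂₄ i).kerC (τ y) (τ y') := hK2 y y'
        _ ≤ c₀ * Real.exp (-(δ₀ * (fam₂₄ i).distU (τ y) (τ y'))) := hC (τ y) (τ y')
        _ ≤ _ := by rw [hdU y y']; exact mul_le_mul_of_nonneg_right hbig (Real.exp_nonneg _)
    · calc |D.K3 j ν y x'| ≤ (fam₂₄ i).kerDGQ (dir ν) (σ x') (τ y) := hK3 ν y x'
        _ ≤ c₀ * Real.exp (-(δ₀ * (fam₂₄ i).distF (σ x') (τ y))) := hDGQ (dir ν) (σ x') (τ y)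
        _ ≤ _ := by rw [hdF x' y]; exact mul_le_mul_of_nonneg_right hbig (Real.exp_nonneg _)
    · calc |P.K3n j y x'| ≤ (fam₂₄ i).kerGQ (σ x') (τ y) := hK3n y x'
        _ ≤ c₀ * Real.exp (-(δ₀ * (fam₂₄ i).distF (σ x') (τ y))) := hGQ (σ x') (τ y)
        _ ≤ _ := by rw [hdF x' y]; exact mul_le_mul_of_nonneg_right hbig (Real.exp_nonneg _)
    · obtain ⟨Nρ, hNρ⟩ : ∃ Nρ : ℝ, Nρ = L ^ (S.k - j) * D.distX x₁ x₂ := ⟨_, rfl⟩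
      have hNρ0 : 0 ≤ Nρ := by rw [hNρ]; exact mul_nonneg (pow_nonneg hL0 _) (G.distX_nonneg _ _)
      rw [← hNρ, Real.rpow_one]
      have he₁ := Real.exp_nonneg (-(δ₀ * D.dXU j x₁ y))
      have he₂ := Real.exp_nonneg (-(δ₀ * D.dXU j x₂ y))
      have hcL : pL * c₀ * Real.exp (δ₀ * pL) ≤ c₀ + pL * c₀ * Real.exp (δ₀ * pL) := by linarith [hc₀.le]
      have hcL' : c₀ ≤ c₀ + pL * c₀ * Real.exp (δ₀ * pL) := by
        have : 0 ≤ pL * c₀ * Real.exp (δ₀ * pL) := by positivity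
        linarith
      rcases le_or_gt Nρ 1 with hnear | hfar
      · obtain ⟨z, μ', hΔ, hdz⟩ := hlip x₁ x₂ y (by rw [← hNρ]; exact hnear)
        have hker : (fam₂₄ i).kerDGQ μ' z (τ y) ≤
            c₀ * Real.exp (δ₀ * pL) * Real.exp (-(δ₀ * D.dXU j x₁ y)) := by
          calc (fam₂₄ i).kerDGQ μ' z (τ y) ≤ c₀ * Real.exp (-(δ₀ * (fam₂₄ i).distF z (τ y))) :=
                hDGQ μ' z (τ y)
            _ ≤ c₀ * (Real.exp (δ₀ * pL) * Real.exp (-(δ₀ * D.dXU j x₁ y))) :=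
                mul_le_mul_of_nonneg_left (B5FromB4.exp_shift hδ₀.le hdz) hc₀.le
            _ = _ := by ring
        calc |P.K1n j x₁ y - P.K1n j x₂ y| ≤ pL * Nρ * (fam₂₄ i).kerDGQ μ' z (τ y) := by
              rw [hNρ]; exact hΔ
          _ ≤ pL * Nρ * (c₀ * Real.exp (δ₀ * pL) * Real.exp (-(δ₀ * D.dXU j x₁ y))) :=
              mul_le_mul_of_nonneg_left hker (mul_nonneg hpL hNρ0)
          _ = pL * c₀ * Real.exp (δ₀ * pL) * Nρ * Real.exp (-(δ₀ * D.dXU j x₁ y)) := by ring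
          _ ≤ (c₀ + pL * c₀ * Real.exp (δ₀ * pL)) * Nρ *
                (Real.exp (-(δ₀ * D.dXU j x₁ y)) + Real.exp (-(δ₀ * D.dXU j x₂ y))) := by
              have h2 : Real.exp (-(δ₀ * D.dXU j x₁ y)) ≤
                  Real.exp (-(δ₀ * D.dXU j x₁ y)) + Real.exp (-(δ₀ * D.dXU j x₂ y)) := by linarith
              exact mul_le_mul (mul_le_mul_of_nonneg_right hcL hNρ0) h2 he₁ (by positivity)
      · calc |P.K1n j x₁ y - P.K1n j x₂ y| ≤ |P.K1n j x₁ y| + |P.K1n j x₂ y| := abs_sub _ _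
          _ ≤ c₀ * Real.exp (-(δ₀ * D.dXU j x₁ y)) + c₀ * Real.exp (-(δ₀ * D.dXU j x₂ y)) :=
              add_le_add (hK1' x₁ y) (hK1' x₂ y)
          _ = c₀ * 1 * (Real.exp (-(δ₀ * D.dXU j x₁ y)) + Real.exp (-(δ₀ * D.dXU j x₂ y))) := by ring
          _ ≤ (c₀ + pL * c₀ * Real.exp (δ₀ * pL)) * Nρ *
                (Real.exp (-(δ₀ * D.dXU j x₁ y)) + Real.exp (-(δ₀ * D.dXU j x₂ y))) := by
              refine mul_le_mul_of_nonneg_right ?_ (by positivity)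
              exact mul_le_mul hcL' hfar.le zero_le_one (by positivity)
  refine ⟨⟨fun μ ν x x' => ?_, fun j hj1 hjk => ?_⟩, ⟨fun μ ν x x' => ?_, fun j hj1 hjk => ?_⟩,
    fun j hj1 hjk μ x₁ x₂ y _ => ?_⟩
  · exact zero_bound (P₁ ν x x') (P.K0R ν x x') _ (hcard₁ ν x x') (hK0R ν x x') (hdist₁ ν x x')
  · obtain ⟨h1, h2, h3, -, -⟩ := mid_bound j hj1 hjk
    exact ⟨fun μ x y => h1 x y, h2, h3⟩
  · exact zero_bound (P₀ x x') (P.K00 x x') _ (hcard₀ x x') (hK00 x x') (hdist₀ x x')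
  · obtain ⟨h1, h2, -, h4, -⟩ := mid_bound j hj1 hjk
    exact ⟨fun μ x y => h1 x y, h2, fun ν y x' => h4 y x'⟩
  · exact (mid_bound j hj1 hjk).2.2.2.2 x₁ x₂ y

/-- **The named residual `B5FromB4.ResidualGpFirst` DISCHARGED, modulo located leaves** — the |G′∇*J|, |ΔG′J|
entries of (1.110) and the ‖ζG′∇*J‖_α entry of (1.111) for the whole family of instances i = (k, T_η) of Prop. 1.2
for G′, from Lemma 2.4 of [2] BY NAME (`B4.Lemma24Printed`), the displays (1.135) for G′_k∂*_ν and G′_k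
(`Display135`, m = 1, 2), the dictionaries `Dict24Gp` (torus ↔ Lemma 2.4 instances — the «whole torus» leaf with
its mean-value field), `LaplaceLeaf` (ΔG′_k = I − a_kQ′*_kQ′_kG′_k), `Dict137`/`DictGp` (scalar bounds ↔ entries),
the model-evident geometry / lattice sums / norm facts / signs, and |a_j| ≤ ā: rate ½δ₀, constants
d(c₀′ + ā²c₀′³R²)e^{(1/2)δ₀c}Λ/(L − 1), d(e^{(1/2)δ₀c} + a(c₀′ + ā²c₀′³R²)e^{(1/2)δ₀(c+cb)}Λ/(L − 1)) (merged by max,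
+ 1 for positivity) and O(1)(α) = 2d((c₀′ + ā²c₀′³R²) + ā²c_Lc₀′²R²)e^{(1/2)δ₀(c+1)}Λ/(L^{1−α} − 1), c₀′ = 4c₀e^{δ₀s₀},
c_L = c₀ + pLc₀e^{δ₀pL}.  [cite: Balaban1984PropagatorsI, (1.110)–(1.111) p.35, (1.135) p.39] -/
theorem residualGpFirst_of_display135 {I I₂₄ : Type} (fam₂₄ : I₂₄ → B4.ScaleSetting)
    (famGp : I → B5.Setting) (F : ∀ i, B5FromB4.GpHolder (famGp i))
    (Dfam : ∀ i, ScaleData (famGp i)) (Pfam : ∀ i, GpData (Dfam i)) (L : ℝ) (d : ℕ)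
    (cc cb ā aK s₀ pL : ℝ) (hL : 1 < L) (hs₀ : 0 ≤ s₀) (hpL : 0 ≤ pL) (haK : 0 ≤ aK)
    (ha : ∀ i j, |(Dfam i).a j| ≤ ā)
    (h135R : ∀ i, Display135 (dataR (Dfam i) (Pfam i)) L d 1)
    (h135Z : ∀ i, Display135 (dataZ (Dfam i) (Pfam i)) L d 2)
    (D24 : ∀ i, Dict24Gp fam₂₄ (Dfam i) (Pfam i) L s₀ pL)
    (Lap : ∀ i, LaplaceLeaf (Dfam i) (Pfam i) aK cb)
    (Dc : ∀ i, Dict137 (Dfam i) d) (DG : ∀ i, DictGp (Dfam i) (Pfam i) (F i) d)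
    (G : ∀ i, Geometry (Dfam i) L cc) (G' : ∀ i, Geometry113 (Dfam i) L)
    (hRow : ∀ κ : ℝ, 0 < κ → ∃ R Λ : ℝ, ∀ i, RowSums (Dfam i) L d κ R Λ)
    (N : ∀ i, NormFacts (Dfam i)) (Sg : ∀ i, B5FromB4.ModelSigns (famGp i)) :
    B4.Lemma24Printed fam₂₄ → B5FromB4.ResidualGpFirst famGp F := by
  intro h24
  obtain ⟨c₀, δ₀, hc₀, hδ₀, H24, -⟩ := h24
  obtain ⟨R, Λ, hRw⟩ := hRow (δ₀ / 4) (by positivity)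
  have hL0 : 0 < L := lt_trans zero_lt_one hL
  obtain ⟨c₀', hc₀'⟩ : ∃ c : ℝ, c = 4 * c₀ * Real.exp (δ₀ * s₀) := ⟨_, rfl⟩
  obtain ⟨cL, hcL⟩ : ∃ c : ℝ, c = c₀ + pL * c₀ * Real.exp (δ₀ * pL) := ⟨_, rfl⟩
  have hc₀'0 : 0 ≤ c₀' := by rw [hc₀']; positivity
  have hcL0 : 0 ≤ cL := by rw [hcL]; positivity
  have hleaf : ∀ i, Leaf235to237 (dataR (Dfam i) (Pfam i)) L c₀' δ₀ ∧
      Leaf235to237 (dataZ (Dfam i) (Pfam i)) L c₀' δ₀ ∧ Leaf236 (dataR (Dfam i) (Pfam i)) L 1 cL δ₀ := by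
    intro i; rw [hc₀', hcL]
    exact leafGp_of_lemma24 hc₀ hδ₀ H24 (Dfam i) (Pfam i) L s₀ pL cc hL.le hs₀ hpL (G i) (D24 i)
  -- the constants
  obtain ⟨CW, hCW⟩ : ∃ C : ℝ, C = c₀' + ā ^ 2 * c₀' ^ 3 * R ^ 2 := ⟨_, rfl⟩
  have hCW0 : 0 ≤ CW := by rw [hCW]; positivity
  obtain ⟨C₂, hC₂⟩ : ∃ C : ℝ, C = d * (CW * Real.exp (δ₀ / 2 * cc) * Λ / (L - 1)) := ⟨_, rfl⟩
  obtain ⟨C₃, hC₃⟩ : ∃ C : ℝ,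
      C = d * (Real.exp (δ₀ / 2 * cc) + aK * (CW * Real.exp (δ₀ / 2 * (cc + cb)) * Λ / (L - 1))) :=
    ⟨_, rfl⟩
  obtain ⟨Cs, hCs⟩ : ∃ C : ℝ, C = max (max C₂ C₃) 0 + 1 := ⟨_, rfl⟩
  have hCs0 : 0 < Cs := by
    rw [hCs]; exact lt_of_lt_of_le zero_lt_one (le_add_of_nonneg_left (le_max_right _ _))
  have hC₂le : C₂ ≤ Cs := by
    rw [hCs]; exact ((le_max_left _ _).trans (le_max_left _ _)).trans (le_add_of_nonneg_right zero_le_one)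
  have hC₃le : C₃ ≤ Cs := by
    rw [hCs]; exact ((le_max_right _ _).trans (le_max_left _ _)).trans (le_add_of_nonneg_right zero_le_one)
  refine ⟨δ₀ / 2, Cs, fun α => d * (2 * (CW + ā ^ 2 * cL * c₀' ^ 2 * R ^ 2) *
      Real.exp (δ₀ / 2 * (cc + 1)) * Λ / (L ^ (1 - α) - 1)), half_pos hδ₀, hCs0, fun i => ⟨?_, ?_, ?_⟩⟩
  · -- |(G′∇*J)(x)|
    have hΛ0 := (hRw i).Λ_nonneg
    have hgap : 0 < L - 1 := by linarith
    have h110 : Ineq110At (dataR (Dfam i) (Pfam i)) (CW * Real.exp (δ₀ / 2 * cc) * Λ / (L - 1)) (δ₀ / 2) := by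
      rw [hCW]
      exact ineq110At_of_display135 (dataR (Dfam i) (Pfam i)) L d 1 c₀' δ₀ cc ā R Λ hL hc₀'0 hδ₀.le le_rfl
        (ha i) (h135R i) (hleaf i).1 (geometry_dataR (Pfam i) (G i)) (rowSums_dataR (Pfam i) (hRw i))
        (normFacts_dataR (Pfam i) (N i))
    have hE := supEntry2_of_ineq110 (Dfam i) (Pfam i) (F i) d _ (δ₀ / 2) (by positivity) h110 (Dc i) (DG i)
    intro J y y' hJ
    have h := hE J y y' hJ
    rw [← hC₂] at h
    exact B9FromB6.weaken3 h hC₂le hCs0.le ((Sg i).supNorm_nonneg J) le_rfl ((Sg i).dist_nonneg y y')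
  · -- |(ΔG′J)(x)|
    have hΛ0 := (hRw i).Λ_nonneg
    have hgap : 0 < L - 1 := by linarith
    have hnear : Ineq110Near (dataZ (Dfam i) (Pfam i)) (CW * Real.exp (δ₀ / 2 * (cc + cb)) * Λ / (L - 1))
        (δ₀ / 2) cb := by
      rw [hCW]
      exact ineq110Near_of_display135 (dataZ (Dfam i) (Pfam i)) L d 2 c₀' δ₀ cc cb ā R Λ hL hc₀'0 hδ₀.le
        (by norm_num) (ha i) (h135Z i) (hleaf i).2.1 (geometry_dataZ (Pfam i) (G i))
        (geometry113_dataZ (Pfam i) (G' i)) (rowSums_dataZ (Pfam i) (hRw i)) (normFacts_dataZ (Pfam i) (N i))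
    have hE := supEntry3_of_ineq110Near (Dfam i) (Pfam i) (F i) d _ (δ₀ / 2) cc cb aK L (by positivity)
      (by positivity) haK hnear (Lap i) (G i) (Dc i) (DG i) (N i)
    intro J y y' hJ
    have h := hE J y y' hJ
    rw [← hC₃] at h
    exact B9FromB6.weaken3 h hC₃le hCs0.le ((Sg i).supNorm_nonneg J) le_rfl ((Sg i).dist_nonneg y y')
  · -- ‖ζG′∇*J‖_α
    intro α J ζ y y' hα0 hα1 hζ hJ
    have hΛ0 := (hRw i).Λ_nonneg
    have hgap : 0 < L ^ (1 - α) - 1 := by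
      have : 1 < L ^ (1 - α) := Real.one_lt_rpow hL (by linarith)
      linarith
    have h111 : Ineq111At (dataR (Dfam i) (Pfam i)) α (2 * (CW + ā ^ 2 * cL * c₀' ^ 2 * R ^ 2) *
        Real.exp (δ₀ / 2 * (cc + 1)) * Λ / (L ^ (1 - α) - 1)) (δ₀ / 2) := by
      rw [hCW]
      exact ineq111At_of_display135 (dataR (Dfam i) (Pfam i)) L d c₀' cL δ₀ cc ā R Λ α hL hc₀'0 hcL0 hδ₀.le
        hα0 hα1 (ha i) (h135R i) (hleaf i).1 (hleaf i).2.2 (geometry_dataR (Pfam i) (G i))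
        (geometry113_dataR (Pfam i) (G' i)) (rowSums_dataR (Pfam i) (hRw i)) (normFacts_dataR (Pfam i) (N i))
    have h := hS_of_ineq111 (Dfam i) (Pfam i) (F i) d α _ (δ₀ / 2) L cc (by positivity) h111 (G i) (Dc i)
      (DG i) (Sg i) J ζ y y' hζ hJ
    calc (F i).hS J α ζ ≤ d * (2 * (CW + ā ^ 2 * cL * c₀' ^ 2 * R ^ 2) * Real.exp (δ₀ / 2 * (cc + 1)) * Λ /
          (L ^ (1 - α) - 1)) * Real.exp (-(δ₀ / 2 * (famGp i).dist y y')) * (famGp i).cutH α ζ *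
          (famGp i).supNorm J := h
      _ = _ := by ring

/-- **`B5Ineq113.prop12G0_of_B4_via137_113` with `hRes` discharged as well**: S3 of B5 Prop. 1.2 (for G₀ = G′ with
the averaging Q) from [2] = B4 with the second-order entries (1.112)–(1.113) AND the residual first-order entries
|G′∇*J|, |ΔG′J|, ‖ζG′∇*J‖_α kernel-checked from (1.135)–(1.137) and (2.35)–(2.37) — B4's Theorem (printed
dependence) and Lemma 2.4 by name, the displays, the dictionaries, the model-evident facts, and the passage's
remaining sentences (p. 39: «we have Proposition 1.1 for G₀», «This leads also to (1.114) by the same reasoning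
with a random walk expansion as for G», «We only have to know some weak bounds for G₀») as the named hypotheses
they are in `B5FromB4`.  [cite: Balaban1984PropagatorsI, pp.39–40] -/
theorem prop12G0_of_B4_via135 {I I₄ I₂₄ : Type} (fam₄ : I₄ → B4.EtaSetting)
    (fam₂₄ : I₂₄ → B4.ScaleSetting) (famGp famG0 : I → B5.Setting) (F : ∀ i, B5FromB4.GpHolder (famGp i))
    (c : ℝ) (ι : I → ℝ → I₄)
    (Dι : ∀ (i : I) (e : ℝ), 0 < e → B5FromB4.Dict (fam₄ (ι i e)) (famGp i) (F i) c e)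
    (SgGp : ∀ i, B5FromB4.ModelSigns (famGp i)) (SgG0 : ∀ i, B5FromB4.ModelSigns (famG0 i))
    (hThm : B5FromB4.ThmDepPrinted fam₄) (h24 : B4.Lemma24Printed fam₂₄)
    (Dfam : ∀ i, ScaleData (famGp i)) (Pfam : ∀ i, GpData (Dfam i)) (L : ℝ) (d : ℕ)
    (cc cb ā aK s₀ pL : ℝ) (hL : 1 < L) (hs₀ : 0 ≤ s₀) (hpL : 0 ≤ pL) (haK : 0 ≤ aK)
    (ha : ∀ i j, |(Dfam i).a j| ≤ ā)
    (h136 : ∀ i, Display136 (Dfam i) L d) (Z : ∀ i, RowZero (Dfam i))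
    (h135R : ∀ i, Display135 (dataR (Dfam i) (Pfam i)) L d 1)
    (h135Z : ∀ i, Display135 (dataZ (Dfam i) (Pfam i)) L d 2)
    (D24 : ∀ i, Dict24 fam₂₄ (Dfam i) L s₀) (D236 : ∀ i, Dict236 fam₂₄ (Dfam i) L)
    (D24G : ∀ i, Dict24Gp fam₂₄ (Dfam i) (Pfam i) L s₀ pL)
    (Lap : ∀ i, LaplaceLeaf (Dfam i) (Pfam i) aK cb)
    (Dc : ∀ i, Dict137 (Dfam i) d) (Dc' : ∀ i, Dict113 (Dfam i) d)
    (DG : ∀ i, DictGp (Dfam i) (Pfam i) (F i) d)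
    (G : ∀ i, Geometry (Dfam i) L cc) (G' : ∀ i, Geometry113 (Dfam i) L)
    (hRow : ∀ κ : ℝ, 0 < κ → ∃ R Λ : ℝ, ∀ i, RowSums (Dfam i) L d κ R Λ)
    (N : ∀ i, NormFacts (Dfam i))
    (h11G0 : B5.Prop11Printed famG0)
    (h114G0 : B5.Prop11Printed famG0 → B5.Local114Fam famG0)
    (transfer : B5FromB4.FirstOrderFam famGp → B5FromB4.SecondOrderFam famGp → B5.Local114Fam famG0 →
      B5FromB4.FirstOrderFam famG0 ∧ B5FromB4.SecondOrderFam famG0) :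
    B5.Prop12Printed famG0 :=
  prop12G0_of_B4_via137_113 fam₄ fam₂₄ famGp famG0 F c ι Dι SgGp SgG0 hThm h24
    (residualGpFirst_of_display135 fam₂₄ famGp F Dfam Pfam L d cc cb ā aK s₀ pL hL hs₀ hpL haK ha h135R
      h135Z D24G Lap Dc DG G G' hRow N SgGp h24)
    Dfam L d cc ā s₀ hL hs₀ ha h136 Z D24 D236 Dc Dc' G G' hRow N h11G0 h114G0 transfer

end Literature.MathematicalPhysics.QuantumFieldTheory.Balaban1983to89.B5Ineq110Gp
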